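import Literature.MathematicalPhysics.KineticTheory.InfiniteChainSuperstableDynamics
import Literature.MathematicalPhysics.KineticTheory.InfiniteChainSevered
import Literature.MathematicalPhysics.KineticTheory.InfiniteChainDynamicsCondB1
import HarnessLib

/-!
# Buttà–Marchioro 2016, Theorem 2.1 (`d = ν = 1`): the estimates for the partial dynamics

Topic `Literature/MathematicalPhysics/KineticTheory`; first of the two proofs-only companions of
`InfiniteChainSuperstableDynamics.lean` through which the named fact
`OscillatorChain.ButtaMarchioro2016_thm21_chain` (P. Buttà, C. Marchioro, *Dynamics of infinite
classical anharmonic crystals*, J. Stat. Phys. **164** (2016) 680–692 = arXiv:1602.01294, §2 Thm 2.1,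
proof in §3) is discharged; the discharge itself (`ButtaMarchioro2016_thm21_chain_holds`: the limit
flow, the growth bound (2.7), uniqueness, group law) is in
`InfiniteChainSuperstableDynamicsProofs.lean`, which imports this file. Here: the quantitative core
of BM §3, eqs. (3.1)–(3.13), for the chain, in the tree's frame (`OscillatorChain.IsSolution`, the
severed flows `severedFlow` of LLL (9a)–(9c) as the partial dynamics, `bmLocalEnergy = W_{μ,k}`,
`bmGrowth = Q`, `bmGood = 𝒳₀`).

## Contents (all proved; no definitions, no named facts)

1. **Polynomials** (`IsEvenPolyOfDegree`): smoothness, evenness, the bounds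
   `|U'| ≤ C(1+|x|)^{2s-1}`, `|U''| ≤ C(1+|x|)^{2s-2}` (`exists_deriv_bound`) and the coercivity
   `(1+|x|)^{2s} ≤ C(U(x)+1)` (`exists_one_add_abs_pow_le`).
2. **Local energies**: site/bond terms `≤ W_{μ,k}`, `W_{μ,k} ≥ 2k+1`, monotonicity in `k`, and on
   `𝒳₀`: `W_{μ,k} ≤ Q(2k+1)` for `k > log(e+|μ|)`, `W_{μ,k} ≤ Q(2k + 2log(e+|μ|) + 3)` in general
   (BM (3.7)); conversely membership in `𝒳₀` from box bounds (`mem_bmGood_of_le`).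
3. **Partial dynamics** (BM (3.1)–(3.2), (3.6)–(3.8)). BM use FREE boundary conditions in
   `Λ_{μ,n}`; we use the tree's severed flows `T^Λ_t` (particles outside `Λ` tied down; global
   existence `condB1_of_bddBelow`), for which the same estimates hold: conservation of the severed
   energy on the chain configuration (`sevEnergy_eq_of_isSeveredSolution`, from the tree's
   `hasDerivWithinAt_sevEnergy`), `H_Λ ≤ W_{μ,n+1}`, `W_{μ,n}(T_t x) ≤ 3 W_{μ,n+1}(x)` (the factor
   `3` instead of BM's equality (3.6) accounts for the ordered-pair convention of (2.4)), site, bond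
   and displacement bounds (`severedFlow_energy_bounds`, `severedFlow_displacement_le`,
   `severedFlow_energy_format`).
4. **The Dobrushin–Fritz iteration** (BM (3.3)–(3.9)): the two-sided integration step
   (`abs_le_of_deriv_two_bound`, Mathlib's fencing theorem), the force Lipschitz bound
   (`force_sub_force_le`) and `df_iterate`: `|Δq_i(s)| ≤ D Θ^d |s|^{2d}/(2d)!`,
   `|Δp_i(s)| ≤ D Θ^d |s|^{2d-1}/(2d-1)!` at depth `d`; `exists_constants` packages the polynomial
   constants: `Θ ≤ K₁ W^η` (`η = (σ-1)/σ`, `σ = max{s₁,s₂}`, BM (3.4)–(3.5)), positions `≤ K₂ W`,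
   `U`, `V` `K₂W`-Lipschitz near the energy level; `df_iterate_energy` feeds `df_iterate` with
   energy-type bounds (`D = 2t(2W)^{1/2}`).
5. **Summability** (BM (3.10)–(3.13)). `bm_arith`: with `(2d)! ≥ (2d/e)^{2d}` in place of
   Stirling's formula, for `d ≥ A (1 + t²(1+t^{β'}) Q^γ)^{1/(2-γ)} L'` (`γ ∈ (η,2)`, `β' > 0`) the
   iterated bound is `≤ 64^{-d}` (any fixed rate, by enlarging `A`). `consecutive_estimate`: for
   `n ≥ n_k^* = 2k + 2 + A X log(e+|μ|)` the severed flows in `Λ_{μ,n+1}` and `Λ_{μ,n}` differ on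
   `Λ_{μ,k}`, `|s| ≤ t`, by `≤ 64^{-(n+1-k)}` in position and
   `≤ t K Q^η (2k + 2log(e+|μ|) + 7) 32^{-(n-k)}` in momentum.

`InfiniteChainUniquenessProofs.lean` (LLL Thm 2) and `EvenPolynomialPotentials.lean` are not
imported (not built on the elaboration farm at the time of writing): the one-sided integration step of
the former is re-derived inside `abs_le_of_deriv_two_bound` (two-sided form), the force bound in the
form needed here (separate exponents for `U''` and `V''`, bond elongations bounded directly), and the
polynomial bounds in the `(1+|x|)^d` format used throughout. Mathlib:
`image_norm_le_of_norm_deriv_right_le_deriv_boundary`, `Convex.norm_image_sub_le_of_norm_deriv_le`,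
`Convex.norm_image_sub_le_of_norm_hasDerivWithin_le`, `Real.pow_div_factorial_le_exp`.

## References

* P. Buttà, C. Marchioro, J. Stat. Phys. 164 (2016) 680–692, doi:10.1007/s10955-016-1540-x,
  arXiv:1602.01294: §2 (2.3)–(2.7), §3 eqs. (3.1)–(3.13). [ButtaMarchioro2016]
* O. E. Lanford III, J. L. Lebowitz, E. H. Lieb, J. Stat. Phys. 16 (1977) 453–461: §2 (severed
  dynamics (9a)–(9c), the severed energy in the proof of Thm 1), §3 Thm 2 (the iteration).
  [LanfordLebowitzLieb1977]
-/

noncomputable section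

open MeasureTheory Filter Set Metric
open scoped Topology BigOperators

namespace Literature.MathematicalPhysics.KineticTheory.HeatConduction

namespace OscillatorChain

/-! ### §1 Even polynomials: smoothness, derivative bounds, coercivity -/

section Poly

variable {f : ℝ → ℝ} {s : ℕ}

/-- An even polynomial (in the sense of `IsEvenPolyOfDegree`) is `C²` (indeed smooth; `C²` is what the
severed dynamics needs). [folklore] -/
theorem IsEvenPolyOfDegree.contDiff_two (h : IsEvenPolyOfDegree f s) : ContDiff ℝ 2 f := by
  obtain ⟨a, -, hf, -⟩ := h
  rw [show f = fun x => ∑ m ∈ Finset.range (s + 1), a m * x ^ (2 * m) from funext hf]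
  fun_prop

/-- An even polynomial is invariant under `x ↦ -x` (as an identity of functions). [folklore] -/
theorem IsEvenPolyOfDegree.comp_neg (h : IsEvenPolyOfDegree f s) : (fun x => f (-x)) = f := by
  obtain ⟨a, -, hf, -⟩ := h
  funext x
  rw [hf, hf]
  refine Finset.sum_congr rfl fun m _ => ?_
  rw [pow_mul, pow_mul, neg_sq]

/-- `|x|^j ≤ (1 + |x|)^d` for `j ≤ d`. [folklore] -/
theorem abs_pow_le_pow_one_add_abs {x : ℝ} {j d : ℕ} (h : j ≤ d) :
    |x| ^ j ≤ (1 + |x|) ^ d := by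
  calc |x| ^ j ≤ (1 + |x|) ^ j :=
        pow_le_pow_left₀ (abs_nonneg x) (by linarith [abs_nonneg x]) j
    _ ≤ (1 + |x|) ^ d := pow_le_pow_right₀ (by linarith [abs_nonneg x]) h

/-- The first two derivatives of an even polynomial of degree `2s`, with the bounds
`|f'(x)| ≤ C (1+|x|)^{2s-1}`, `|f''(x)| ≤ C (1+|x|)^{2s-2}`. [folklore] -/
theorem IsEvenPolyOfDegree.exists_deriv_bound (h : IsEvenPolyOfDegree f s) :
    ∃ C : ℝ, 0 ≤ C ∧ (∀ x, |deriv f x| ≤ C * (1 + |x|) ^ (2 * s - 1)) ∧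
      ∀ x, |deriv (deriv f) x| ≤ C * (1 + |x|) ^ (2 * s - 2) := by
  obtain ⟨a, -, hf, -⟩ := h
  -- first derivative
  have hd1 : ∀ x, HasDerivAt f (∑ m ∈ Finset.range (s + 1), a m * ((2 * m : ℕ) * x ^ (2 * m - 1))) x := by
    intro x
    rw [show f = fun x => ∑ m ∈ Finset.range (s + 1), a m * x ^ (2 * m) from funext hf]
    exact HasDerivAt.fun_sum fun m _ => (hasDerivAt_pow (2 * m) x).const_mul (a m)
  have hderiv : deriv f = fun x => ∑ m ∈ Finset.range (s + 1), a m * ((2 * m : ℕ) * x ^ (2 * m - 1)) :=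
    funext fun x => (hd1 x).deriv
  -- second derivative
  have hd2 : ∀ x, HasDerivAt (deriv f)
      (∑ m ∈ Finset.range (s + 1), a m * ((2 * m : ℕ) * ((2 * m - 1 : ℕ) * x ^ (2 * m - 1 - 1)))) x := by
    intro x
    rw [hderiv]
    exact HasDerivAt.fun_sum fun m _ =>
      ((hasDerivAt_pow (2 * m - 1) x).const_mul ((2 * m : ℕ) : ℝ)).const_mul (a m)
  have hderiv2 : deriv (deriv f) = fun x =>
      ∑ m ∈ Finset.range (s + 1), a m * ((2 * m : ℕ) * ((2 * m - 1 : ℕ) * x ^ (2 * m - 1 - 1))) :=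
    funext fun x => (hd2 x).deriv
  set C₁ : ℝ := ∑ m ∈ Finset.range (s + 1), |a m| * (2 * m : ℕ) with hC₁
  set C₂ : ℝ := ∑ m ∈ Finset.range (s + 1), |a m| * ((2 * m : ℕ) * (2 * m - 1 : ℕ)) with hC₂
  have hC₁0 : 0 ≤ C₁ := Finset.sum_nonneg fun m _ => by positivity
  have hC₂0 : 0 ≤ C₂ := Finset.sum_nonneg fun m _ => by positivity
  refine ⟨max C₁ C₂, le_max_of_le_left hC₁0, fun x => ?_, fun x => ?_⟩
  · rw [hderiv]
    calc |∑ m ∈ Finset.range (s + 1), a m * ((2 * m : ℕ) * x ^ (2 * m - 1))|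
        ≤ ∑ m ∈ Finset.range (s + 1), |a m * ((2 * m : ℕ) * x ^ (2 * m - 1))| :=
          Finset.abs_sum_le_sum_abs _ _
      _ ≤ ∑ m ∈ Finset.range (s + 1), |a m| * (2 * m : ℕ) * (1 + |x|) ^ (2 * s - 1) := by
          refine Finset.sum_le_sum fun m hm => ?_
          have hms : m < s + 1 := Finset.mem_range.1 hm
          rw [abs_mul, abs_mul, abs_pow, Nat.abs_cast, mul_assoc]
          refine mul_le_mul_of_nonneg_left (mul_le_mul_of_nonneg_left
            (abs_pow_le_pow_one_add_abs (by omega)) (by positivity)) (abs_nonneg _)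
      _ = C₁ * (1 + |x|) ^ (2 * s - 1) := by rw [hC₁, Finset.sum_mul]
      _ ≤ max C₁ C₂ * (1 + |x|) ^ (2 * s - 1) :=
          mul_le_mul_of_nonneg_right (le_max_left _ _) (by positivity)
  · rw [hderiv2]
    calc |∑ m ∈ Finset.range (s + 1), a m * ((2 * m : ℕ) * ((2 * m - 1 : ℕ) * x ^ (2 * m - 1 - 1)))|
        ≤ ∑ m ∈ Finset.range (s + 1), |a m * ((2 * m : ℕ) * ((2 * m - 1 : ℕ) * x ^ (2 * m - 1 - 1)))| :=
          Finset.abs_sum_le_sum_abs _ _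
      _ ≤ ∑ m ∈ Finset.range (s + 1), |a m| * ((2 * m : ℕ) * (2 * m - 1 : ℕ)) * (1 + |x|) ^ (2 * s - 2) := by
          refine Finset.sum_le_sum fun m hm => ?_
          have hms : m < s + 1 := Finset.mem_range.1 hm
          rw [abs_mul, abs_mul, abs_mul, abs_pow, Nat.abs_cast, Nat.abs_cast]
          have h1 : |x| ^ (2 * m - 1 - 1) ≤ (1 + |x|) ^ (2 * s - 2) :=
            abs_pow_le_pow_one_add_abs (by omega)
          have h2 : (0 : ℝ) ≤ |a m| * ((2 * m : ℕ) * (2 * m - 1 : ℕ)) := by positivity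
          calc |a m| * ((2 * m : ℕ) * ((2 * m - 1 : ℕ) * |x| ^ (2 * m - 1 - 1)))
              = |a m| * ((2 * m : ℕ) * (2 * m - 1 : ℕ)) * |x| ^ (2 * m - 1 - 1) := by ring
            _ ≤ |a m| * ((2 * m : ℕ) * (2 * m - 1 : ℕ)) * (1 + |x|) ^ (2 * s - 2) :=
                mul_le_mul_of_nonneg_left h1 h2
      _ = C₂ * (1 + |x|) ^ (2 * s - 2) := by rw [hC₂, Finset.sum_mul]
      _ ≤ max C₁ C₂ * (1 + |x|) ^ (2 * s - 2) :=
          mul_le_mul_of_nonneg_right (le_max_right _ _) (by positivity)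

/-- **Coercivity of an even polynomial with positive leading coefficient**:
`(1 + |x|)^{2s} ≤ C (f(x) + 1)` for all `x`. [folklore] -/
theorem IsEvenPolyOfDegree.exists_one_add_abs_pow_le (h : IsEvenPolyOfDegree f s) (hs : 1 ≤ s) :
    ∃ C : ℝ, 1 ≤ C ∧ ∀ x, (1 + |x|) ^ (2 * s) ≤ C * (f x + 1) := by
  obtain ⟨a, ha, hf, hnn⟩ := h
  -- the lower-order part is bounded by `B (1+|x|)^{2s-2}`
  set B : ℝ := ∑ m ∈ Finset.range s, |a m| with hB
  have hB0 : 0 ≤ B := Finset.sum_nonneg fun m _ => abs_nonneg _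
  have hsplit : ∀ x, f x = a s * x ^ (2 * s) + ∑ m ∈ Finset.range s, a m * x ^ (2 * m) := by
    intro x
    rw [hf, Finset.sum_range_succ, add_comm]
  have hlow : ∀ x, |∑ m ∈ Finset.range s, a m * x ^ (2 * m)| ≤ B * (1 + |x|) ^ (2 * s - 2) := by
    intro x
    calc |∑ m ∈ Finset.range s, a m * x ^ (2 * m)|
        ≤ ∑ m ∈ Finset.range s, |a m * x ^ (2 * m)| := Finset.abs_sum_le_sum_abs _ _
      _ ≤ ∑ m ∈ Finset.range s, |a m| * (1 + |x|) ^ (2 * s - 2) := by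
          refine Finset.sum_le_sum fun m hm => ?_
          have hms : m < s := Finset.mem_range.1 hm
          rw [abs_mul, abs_pow]
          exact mul_le_mul_of_nonneg_left (abs_pow_le_pow_one_add_abs (by omega)) (abs_nonneg _)
      _ = B * (1 + |x|) ^ (2 * s - 2) := by rw [hB, Finset.sum_mul]
  -- the radius beyond which the leading term dominates
  set R : ℝ := max 1 (Real.sqrt (2 * B * 4 ^ s / a s)) with hR
  have hR1 : 1 ≤ R := le_max_left _ _
  have hR0 : 0 ≤ R := zero_le_one.trans hR1
  set C : ℝ := max ((1 + R) ^ (2 * s)) (2 * 4 ^ s / a s) with hC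
  have hC1 : 1 ≤ C := le_max_of_le_left (one_le_pow₀ (by linarith))
  refine ⟨C, hC1, fun x => ?_⟩
  have hfx : 0 ≤ f x := hnn x
  rcases le_or_gt |x| R with hx | hx
  · -- small `|x|`: `(1+|x|)^{2s} ≤ (1+R)^{2s} ≤ C ≤ C (f x + 1)`
    calc (1 + |x|) ^ (2 * s) ≤ (1 + R) ^ (2 * s) :=
          pow_le_pow_left₀ (by positivity) (by linarith) _
      _ ≤ C := le_max_left _ _
      _ ≤ C * (f x + 1) := le_mul_of_one_le_right (zero_le_one.trans hC1) (by linarith)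
  · -- large `|x|`: the leading term dominates
    have hx1 : 1 ≤ |x| := hR1.trans hx.le
    have hx0 : 0 < |x| := lt_of_lt_of_le one_pos hx1
    have hsq : 2 * B * 4 ^ s / a s ≤ |x| ^ 2 := by
      have h1 : Real.sqrt (2 * B * 4 ^ s / a s) ≤ |x| := (le_max_right _ _).trans hx.le
      have h2 : 0 ≤ 2 * B * 4 ^ s / a s := by positivity
      calc 2 * B * 4 ^ s / a s = Real.sqrt (2 * B * 4 ^ s / a s) ^ 2 := (Real.sq_sqrt h2).symm
        _ ≤ |x| ^ 2 := pow_le_pow_left₀ (Real.sqrt_nonneg _) h1 2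
    have hsq' : 2 * B * 4 ^ s ≤ a s * |x| ^ 2 := by
      have := (div_le_iff₀ ha).1 hsq
      linarith
    -- `(1+|x|)^{2s} ≤ (2|x|)^{2s} = 4^s |x|^{2s}`
    have hup : (1 + |x|) ^ (2 * s) ≤ 4 ^ s * |x| ^ (2 * s) := by
      calc (1 + |x|) ^ (2 * s) ≤ (2 * |x|) ^ (2 * s) :=
            pow_le_pow_left₀ (by positivity) (by linarith) _
        _ = 4 ^ s * |x| ^ (2 * s) := by rw [mul_pow, pow_mul, pow_mul]; norm_num
    have hup' : (1 + |x|) ^ (2 * s - 2) ≤ 4 ^ s * |x| ^ (2 * s - 2) := by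
      calc (1 + |x|) ^ (2 * s - 2) ≤ (2 * |x|) ^ (2 * s - 2) :=
            pow_le_pow_left₀ (by positivity) (by linarith) _
        _ = 2 ^ (2 * s - 2) * |x| ^ (2 * s - 2) := by rw [mul_pow]
        _ ≤ 4 ^ s * |x| ^ (2 * s - 2) := by
            refine mul_le_mul_of_nonneg_right ?_ (by positivity)
            calc (2 : ℝ) ^ (2 * s - 2) ≤ 2 ^ (2 * s) := pow_le_pow_right₀ (by norm_num) (by omega)
              _ = 4 ^ s := by rw [pow_mul]; norm_num
    -- `f x ≥ a_s x^{2s} - B 4^s |x|^{2s-2} ≥ (a_s/2) x^{2s}`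
    have hpow : |x| ^ (2 * s) = |x| ^ (2 * s - 2) * |x| ^ 2 := by
      rw [← pow_add]; congr 1; omega
    have hxpow : x ^ (2 * s) = |x| ^ (2 * s) := by rw [pow_mul, pow_mul, sq_abs]
    have hlead : a s * |x| ^ (2 * s) / 2 ≤ f x := by
      have h1 := hlow x
      have h2 : -(B * (1 + |x|) ^ (2 * s - 2)) ≤ ∑ m ∈ Finset.range s, a m * x ^ (2 * m) :=
        (abs_le.1 h1).1
      have h3 : B * (1 + |x|) ^ (2 * s - 2) ≤ B * (4 ^ s * |x| ^ (2 * s - 2)) :=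
        mul_le_mul_of_nonneg_left hup' hB0
      have h4 : B * (4 ^ s * |x| ^ (2 * s - 2)) * 2 ≤ a s * |x| ^ (2 * s) := by
        rw [hpow]
        have : 0 ≤ |x| ^ (2 * s - 2) := by positivity
        nlinarith
      rw [hsplit x, hxpow]
      linarith
    calc (1 + |x|) ^ (2 * s) ≤ 4 ^ s * |x| ^ (2 * s) := hup
      _ = 2 * 4 ^ s / a s * (a s * |x| ^ (2 * s) / 2) := by field_simp
      _ ≤ C * (a s * |x| ^ (2 * s) / 2) :=
          mul_le_mul_of_nonneg_right (le_max_right _ _) (by positivity)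
      _ ≤ C * (f x + 1) := mul_le_mul_of_nonneg_left (by linarith) (zero_le_one.trans hC1)

/-- From coercivity: `(1+|x|)^{2m} ≤ (C (f x + 1))^{m/s}` for `m ≤ s` (real power). [folklore] -/
theorem one_add_abs_pow_le_rpow {C : ℝ} (hC : ∀ x, (1 + |x|) ^ (2 * s) ≤ C * (f x + 1))
    (hs : 1 ≤ s) {m : ℕ} (x : ℝ) :
    (1 + |x|) ^ (2 * m) ≤ (C * (f x + 1)) ^ ((m : ℝ) / s) := by
  have hs0 : (0 : ℝ) < s := by exact_mod_cast hs
  have hbase : 0 ≤ 1 + |x| := by positivity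
  have h1 : ((1 + |x|) ^ (2 * s)) ^ ((m : ℝ) / s) = (1 + |x|) ^ (2 * m) := by
    rw [← Real.rpow_natCast (1 + |x|) (2 * s), ← Real.rpow_mul hbase]
    have : ((2 * s : ℕ) : ℝ) * ((m : ℝ) / s) = ((2 * m : ℕ) : ℝ) := by
      push_cast
      field_simp
    rw [this, Real.rpow_natCast]
  rw [← h1]
  exact Real.rpow_le_rpow (by positivity) (hC x) (by positivity)

end Poly

/-! ### §2 The local energies `W_{μ,k}` and the growth functional `Q` -/

section LocalEnergy

variable (P : OscillatorChain)

/-- The boxes `Λ_{μ,k}` increase with `k`. [folklore] -/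
theorem cbox_subset {μ : ℤ} {k k' : ℕ} (h : k ≤ k') :
    Finset.Icc (μ - k) (μ + k) ⊆ Finset.Icc (μ - k') (μ + k') := by
  intro i hi
  rw [Finset.mem_Icc] at hi ⊢
  have : (k : ℤ) ≤ k' := by exact_mod_cast h
  omega

/-- The centre belongs to its boxes. [folklore] -/
theorem mem_cbox_self (μ : ℤ) (k : ℕ) : μ ∈ Finset.Icc (μ - k) (μ + k) := by
  rw [Finset.mem_Icc]; omega

/-- The cardinality of `Λ_{μ,k}` is `2k+1`. [folklore] -/
theorem card_cbox (μ : ℤ) (k : ℕ) : (Finset.Icc (μ - k) (μ + k)).card = 2 * k + 1 := by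
  rw [Int.card_Icc]
  omega

variable {P}

/-- The pair (interaction) part of `W_{μ,k}` is non-negative when `V ≥ 0`. [folklore] -/
theorem bmPair_nonneg (hV0 : ∀ r, 0 ≤ P.V r) (B : Finset ℤ) (σ : ChainConfig) :
    0 ≤ ∑ i ∈ B, ∑ j ∈ B, (if |j - i| = 1 then P.V ((σ i).1 - (σ j).1) else 0) :=
  Finset.sum_nonneg fun i _ => Finset.sum_nonneg fun j _ => by
    split_ifs
    · exact hV0 _
    · exact le_rfl

/-- **Site bound**: for `i ∈ Λ_{μ,k}`, `p_i²/2 + U(q_i) + 1 ≤ W_{μ,k}(σ)` (`U, V ≥ 0`). [folklore] -/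
theorem site_le_bmLocalEnergy (hU0 : ∀ r, 0 ≤ P.U r) (hV0 : ∀ r, 0 ≤ P.V r) {μ : ℤ} {k : ℕ}
    (σ : ChainConfig) {i : ℤ} (hi : i ∈ Finset.Icc (μ - k) (μ + k)) :
    (σ i).2 ^ 2 / 2 + P.U (σ i).1 + 1 ≤ P.bmLocalEnergy μ k σ := by
  unfold bmLocalEnergy
  have h1 : (σ i).2 ^ 2 / 2 + P.U (σ i).1 + 1 ≤
      ∑ i ∈ Finset.Icc (μ - k) (μ + k), ((σ i).2 ^ 2 / 2 + P.U (σ i).1 + 1) :=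
    Finset.single_le_sum (f := fun i => (σ i).2 ^ 2 / 2 + P.U (σ i).1 + 1)
      (fun j _ => by have := hU0 (σ j).1; positivity) hi
  linarith [bmPair_nonneg hV0 (Finset.Icc (μ - k) (μ + k)) σ]

/-- **Bond bound**: for `i, i-1 ∈ Λ_{μ,k}`, `V(q_i - q_{i-1}) ≤ W_{μ,k}(σ)` (`U, V ≥ 0`). [folklore] -/
theorem bond_le_bmLocalEnergy (hU0 : ∀ r, 0 ≤ P.U r) (hV0 : ∀ r, 0 ≤ P.V r) {μ : ℤ} {k : ℕ}
    (σ : ChainConfig) {i : ℤ} (hi : i ∈ Finset.Icc (μ - k) (μ + k))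
    (hi' : i - 1 ∈ Finset.Icc (μ - k) (μ + k)) :
    P.V ((σ i).1 - (σ (i - 1)).1) ≤ P.bmLocalEnergy μ k σ := by
  unfold bmLocalEnergy
  set B := Finset.Icc (μ - k) (μ + k) with hB
  have h0 : 0 ≤ ∑ i ∈ B, ((σ i).2 ^ 2 / 2 + P.U (σ i).1 + 1) :=
    Finset.sum_nonneg fun j _ => by have := hU0 (σ j).1; positivity
  have h1 : P.V ((σ i).1 - (σ (i - 1)).1) ≤
      ∑ j ∈ B, (if |j - i| = 1 then P.V ((σ i).1 - (σ j).1) else 0) := by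
    have := Finset.single_le_sum (f := fun j => if |j - i| = 1 then P.V ((σ i).1 - (σ j).1) else 0)
      (fun j _ => by
        show (0 : ℝ) ≤ if |j - i| = 1 then P.V ((σ i).1 - (σ j).1) else 0
        split_ifs
        · exact hV0 _
        · exact le_rfl) hi'
    have e : |i - 1 - i| = 1 := by norm_num
    simpa [e] using this
  have h2 : ∑ j ∈ B, (if |j - i| = 1 then P.V ((σ i).1 - (σ j).1) else 0) ≤
      ∑ i ∈ B, ∑ j ∈ B, (if |j - i| = 1 then P.V ((σ i).1 - (σ j).1) else 0) :=
    Finset.single_le_sum (f := fun i => ∑ j ∈ B, (if |j - i| = 1 then P.V ((σ i).1 - (σ j).1) else 0))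
      (fun i' _ => Finset.sum_nonneg fun j _ => by
        show (0 : ℝ) ≤ if |j - i'| = 1 then P.V ((σ i').1 - (σ j).1) else 0
        split_ifs
        · exact hV0 _
        · exact le_rfl) hi
  linarith

/-- `W_{μ,k}(σ) ≥ 2k + 1` (each site contributes at least `1`). [folklore] -/
theorem card_le_bmLocalEnergy (hU0 : ∀ r, 0 ≤ P.U r) (hV0 : ∀ r, 0 ≤ P.V r) (μ : ℤ) (k : ℕ)
    (σ : ChainConfig) : 2 * (k : ℝ) + 1 ≤ P.bmLocalEnergy μ k σ := by
  unfold bmLocalEnergy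
  have h1 : ∑ i ∈ Finset.Icc (μ - k) (μ + k), (1 : ℝ) ≤
      ∑ i ∈ Finset.Icc (μ - k) (μ + k), ((σ i).2 ^ 2 / 2 + P.U (σ i).1 + 1) :=
    Finset.sum_le_sum fun i _ => by have := hU0 (σ i).1; nlinarith [sq_nonneg (σ i).2]
  have h2 : ∑ i ∈ Finset.Icc (μ - k) (μ + k), (1 : ℝ) = 2 * (k : ℝ) + 1 := by
    rw [Finset.sum_const, card_cbox, nsmul_eq_mul, mul_one]
    push_cast
    ring
  linarith [bmPair_nonneg hV0 (Finset.Icc (μ - k) (μ + k)) σ]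

/-- `W_{μ,k}(σ) ≥ 1`. [folklore] -/
theorem one_le_bmLocalEnergy (hU0 : ∀ r, 0 ≤ P.U r) (hV0 : ∀ r, 0 ≤ P.V r) (μ : ℤ) (k : ℕ)
    (σ : ChainConfig) : 1 ≤ P.bmLocalEnergy μ k σ :=
  le_trans (by have : (0 : ℝ) ≤ k := Nat.cast_nonneg k; linarith) (card_le_bmLocalEnergy hU0 hV0 μ k σ)

/-- **Monotonicity in `k`**: `W_{μ,k} ≤ W_{μ,k'}` for `k ≤ k'` (`U, V ≥ 0`). [folklore] -/
theorem bmLocalEnergy_mono (hU0 : ∀ r, 0 ≤ P.U r) (hV0 : ∀ r, 0 ≤ P.V r) (μ : ℤ) {k k' : ℕ}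
    (h : k ≤ k') (σ : ChainConfig) : P.bmLocalEnergy μ k σ ≤ P.bmLocalEnergy μ k' σ := by
  unfold bmLocalEnergy
  have hsub := cbox_subset (μ := μ) h
  refine add_le_add ?_ ?_
  · exact Finset.sum_le_sum_of_subset_of_nonneg hsub fun i _ _ => by
      have := hU0 (σ i).1; positivity
  · calc ∑ i ∈ Finset.Icc (μ - k) (μ + k), ∑ j ∈ Finset.Icc (μ - k) (μ + k),
          (if |j - i| = 1 then P.V ((σ i).1 - (σ j).1) else 0)
        ≤ ∑ i ∈ Finset.Icc (μ - k) (μ + k), ∑ j ∈ Finset.Icc (μ - k') (μ + k'),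
          (if |j - i| = 1 then P.V ((σ i).1 - (σ j).1) else 0) :=
          Finset.sum_le_sum fun i _ => Finset.sum_le_sum_of_subset_of_nonneg hsub fun j _ _ => by
            split_ifs
            · exact hV0 _
            · exact le_rfl
      _ ≤ ∑ i ∈ Finset.Icc (μ - k') (μ + k'), ∑ j ∈ Finset.Icc (μ - k') (μ + k'),
          (if |j - i| = 1 then P.V ((σ i).1 - (σ j).1) else 0) :=
          Finset.sum_le_sum_of_subset_of_nonneg hsub fun i _ _ =>
            Finset.sum_nonneg fun j _ => by
              split_ifs
              · exact hV0 _
              · exact le_rfl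

/-- `1 ≤ log(e + |μ|)`. [folklore] -/
theorem one_le_log_exp_add_abs (μ : ℤ) : 1 ≤ Real.log (Real.exp 1 + |(μ : ℝ)|) := by
  have h : Real.exp 1 ≤ Real.exp 1 + |(μ : ℝ)| := le_add_of_nonneg_right (abs_nonneg _)
  calc (1 : ℝ) = Real.log (Real.exp 1) := (Real.log_exp 1).symm
    _ ≤ Real.log (Real.exp 1 + |(μ : ℝ)|) := Real.log_le_log (Real.exp_pos 1) h

/-- The set of normalised local energies is non-empty (`μ = 0`, `k = 2`). [folklore] -/
theorem bmGrowthSet_nonempty (σ : ChainConfig) : (P.bmGrowthSet σ).Nonempty := by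
  refine ⟨P.bmLocalEnergy 0 2 σ / (2 * (2 : ℕ) + 1), 0, 2, ?_, rfl⟩
  have : Real.log (Real.exp 1 + |((0 : ℤ) : ℝ)|) = 1 := by simp
  rw [this]
  norm_num

/-- On `𝒳₀` every admissible normalised local energy is at most `Q`. [folklore] -/
theorem bmLocalEnergy_le_of_lt {σ : ChainConfig} (hσ : σ ∈ P.bmGood) {μ : ℤ} {k : ℕ}
    (hk : Real.log (Real.exp 1 + |(μ : ℝ)|) < k) :
    P.bmLocalEnergy μ k σ ≤ P.bmGrowth σ * (2 * (k : ℝ) + 1) := by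
  have hmem : P.bmLocalEnergy μ k σ / (2 * (k : ℝ) + 1) ∈ P.bmGrowthSet σ := ⟨μ, k, hk, rfl⟩
  have h := le_csSup hσ hmem
  have hpos : (0 : ℝ) < 2 * (k : ℝ) + 1 := by positivity
  unfold bmGrowth
  rwa [div_le_iff₀ hpos] at h

/-- `Q(σ) ≥ 1` on `𝒳₀` (`U, V ≥ 0`). [folklore] -/
theorem one_le_bmGrowth (hU0 : ∀ r, 0 ≤ P.U r) (hV0 : ∀ r, 0 ≤ P.V r) {σ : ChainConfig}
    (hσ : σ ∈ P.bmGood) : 1 ≤ P.bmGrowth σ := by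
  have h2 : Real.log (Real.exp 1 + |((0 : ℤ) : ℝ)|) < (2 : ℕ) := by
    have : Real.log (Real.exp 1 + |((0 : ℤ) : ℝ)|) = 1 := by simp
    rw [this]; norm_num
  have h := bmLocalEnergy_le_of_lt hσ h2
  have h' := card_le_bmLocalEnergy hU0 hV0 0 2 σ
  have hpos : (0 : ℝ) < 2 * ((2 : ℕ) : ℝ) + 1 := by positivity
  nlinarith

/-- **The general box bound on `𝒳₀`** (BM (3.7)): `W_{μ,k}(σ) ≤ Q(σ)(2k + 2 log(e+|μ|) + 3)` for
all `μ`, `k` (for `k ≤ log(e+|μ|)` enlarge the box to radius `⌊log(e+|μ|)⌋ + 1`). [cite: ButtaMarchioro2016, §3 eq. (3.7)] -/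
theorem bmLocalEnergy_le (hU0 : ∀ r, 0 ≤ P.U r) (hV0 : ∀ r, 0 ≤ P.V r) {σ : ChainConfig}
    (hσ : σ ∈ P.bmGood) (μ : ℤ) (k : ℕ) :
    P.bmLocalEnergy μ k σ ≤
      P.bmGrowth σ * (2 * (k : ℝ) + 2 * Real.log (Real.exp 1 + |(μ : ℝ)|) + 3) := by
  set L := Real.log (Real.exp 1 + |(μ : ℝ)|) with hL
  have hL1 : 1 ≤ L := one_le_log_exp_add_abs μ
  have hQ1 : 1 ≤ P.bmGrowth σ := one_le_bmGrowth hU0 hV0 hσ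
  by_cases hk : L < k
  · have h := bmLocalEnergy_le_of_lt hσ hk
    nlinarith
  · have hk : (k : ℝ) ≤ L := not_lt.1 hk
    set k' : ℕ := ⌊L⌋₊ + 1 with hk'
    have hk'L : L < k' := by rw [hk']; push_cast; exact Nat.lt_floor_add_one L
    have hk'le : (k' : ℝ) ≤ L + 1 := by
      rw [hk']; push_cast; linarith [Nat.floor_le (zero_le_one.trans hL1)]
    have hkk' : k ≤ k' := by
      have : (k : ℝ) < k' := lt_of_le_of_lt hk hk'L
      exact_mod_cast this.le
    calc P.bmLocalEnergy μ k σ ≤ P.bmLocalEnergy μ k' σ := bmLocalEnergy_mono hU0 hV0 μ hkk' σ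
      _ ≤ P.bmGrowth σ * (2 * (k' : ℝ) + 1) := bmLocalEnergy_le_of_lt hσ hk'L
      _ ≤ P.bmGrowth σ * (2 * (k : ℝ) + 2 * L + 3) := by
          refine mul_le_mul_of_nonneg_left ?_ (zero_le_one.trans hQ1)
          have : (0 : ℝ) ≤ k := Nat.cast_nonneg k
          linarith

/-- **Membership in `𝒳₀` and a bound on `Q` from box bounds.** [folklore] -/
theorem mem_bmGood_of_le {σ : ChainConfig} {M : ℝ}
    (h : ∀ (μ : ℤ) (k : ℕ), Real.log (Real.exp 1 + |(μ : ℝ)|) < k →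
      P.bmLocalEnergy μ k σ / (2 * (k : ℝ) + 1) ≤ M) :
    σ ∈ P.bmGood ∧ P.bmGrowth σ ≤ M := by
  have hub : ∀ r ∈ P.bmGrowthSet σ, r ≤ M := by
    rintro r ⟨μ, k, hk, rfl⟩
    exact h μ k hk
  exact ⟨⟨M, hub⟩, csSup_le (bmGrowthSet_nonempty σ) hub⟩

end LocalEnergy

/-! ### §3 The severed dynamics in a box: energy conservation and local energy bounds -/

section SeveredEnergy

variable {P : OscillatorChain}

/-- A configuration that agrees with `σ` off `Λ` is the gluing of its restriction. [folklore] -/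
theorem sevGlue_restrict_of_eq_off {Λ : Finset ℤ} {σ τ : ChainConfig} (h : ∀ j ∉ Λ, τ j = σ j) :
    sevGlue Λ σ (fun i : Λ => τ i) = τ := by
  funext i
  by_cases hi : i ∈ Λ
  · simp [hi]
  · simp [hi, h i hi]

/-- The severed energy of a glued restriction, written on the chain configuration:
`H_Λ(τ) = ∑_{i∈Λ} (p_i²/2 + U(q_i)) + ∑_{j ∈ sevBonds Λ} V(q_{j+1} - q_j)`. [folklore] -/
theorem sevEnergy_restrict_eq {Λ : Finset ℤ} {σ τ : ChainConfig} (h : ∀ j ∉ Λ, τ j = σ j) :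
    sevEnergy P Λ σ 0 0 (fun i : Λ => τ i) =
      (∑ i ∈ Λ, ((τ i).2 ^ 2 / 2 + P.U (τ i).1)) +
        ∑ j ∈ sevBonds Λ, P.V ((τ (j + 1)).1 - (τ j).1) := by
  unfold sevEnergy
  rw [sevGlue_restrict_of_eq_off h]
  simp only [sub_zero]
  congr 1
  refine Finset.sum_congr rfl fun i hi => ?_
  simp [sevVel, hi]

/-- **Conservation of the severed energy along a severed solution** (on the chain
configuration): `H_Λ(γ t) = H_Λ(γ 0)`. [cite: LanfordLebowitzLieb1977, §2 proof of Thm 1] -/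
theorem sevEnergy_eq_of_isSeveredSolution (hU : ContDiff ℝ 2 P.U) (hV : ContDiff ℝ 2 P.V)
    {Λ : Finset ℤ} {γ : ℝ → ChainConfig} (hγ : P.IsSeveredSolution Λ γ) (t : ℝ) :
    sevEnergy P Λ (γ 0) 0 0 (fun i : Λ => γ t i) = sevEnergy P Λ (γ 0) 0 0 (fun i : Λ => γ 0 i) := by
  have hUd : Differentiable ℝ P.U := hU.differentiable (by simp)
  have hVd : Differentiable ℝ P.V := hV.differentiable (by simp)
  set α : ℝ → Λ → ℝ × ℝ := fun t i => γ t i with hα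
  have hoff : ∀ t, ∀ j ∉ Λ, γ t j = γ 0 j := fun t j hj => hγ.2 j hj t
  have hαd : ∀ t, HasDerivAt α (sevField P Λ (γ 0) (α t)) t := by
    intro t
    rw [hasDerivAt_pi]
    intro i
    have h1 := (hγ.1 i i.2 t).1
    have h2 := (hγ.1 i i.2 t).2
    have hglue : sevGlue Λ (γ 0) (α t) = γ t := sevGlue_restrict_of_eq_off (hoff t)
    have h12 := h1.prodMk h2
    simp only [Prod.mk.eta] at h12
    simpa [sevField, hglue] using h12
  have hE : ∀ t, HasDerivAt (fun τ => sevEnergy P Λ (γ 0) 0 0 (α τ)) 0 t := by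
    intro t
    have h := (hαd t).hasDerivWithinAt (s := Set.univ)
    rw [← one_smul ℝ (sevField P Λ (γ 0) (α t))] at h
    exact (hasDerivWithinAt_sevEnergy P Λ (γ 0) hUd hVd 0 0 1 h).hasDerivAt Filter.univ_mem
  have hdiff : Differentiable ℝ fun τ => sevEnergy P Λ (γ 0) 0 0 (α τ) :=
    fun t => (hE t).differentiableAt
  exact is_const_of_deriv_eq_zero hdiff (fun t => (hE t).deriv) t 0

/-- `sevBonds Λ_{μ,n} ⊆ {μ-n-1, …, μ+n}`. [folklore] -/
theorem sevBonds_cbox_subset (μ : ℤ) (n : ℕ) :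
    sevBonds (Finset.Icc (μ - n) (μ + n)) ⊆ Finset.Icc (μ - n - 1) (μ + n) := by
  intro j hj
  simp only [sevBonds, Finset.mem_union, Finset.mem_image, Finset.mem_Icc] at hj
  rw [Finset.mem_Icc]
  rcases hj with h | ⟨i, hi, rfl⟩ <;> omega

/-- The pair part of `W` over a box is at most twice the bond sum over the bonds meeting the box
(`V ≥ 0` even). [folklore] -/
theorem bmPair_le_two_mul_bonds (hV0 : ∀ r, 0 ≤ P.V r) (hVe : ∀ r, P.V (-r) = P.V r)
    (Λ : Finset ℤ) (τ : ChainConfig) :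
    ∑ i ∈ Λ, ∑ j ∈ Λ, (if |j - i| = 1 then P.V ((τ i).1 - (τ j).1) else 0) ≤
      2 * ∑ j ∈ sevBonds Λ, P.V ((τ (j + 1)).1 - (τ j).1) := by
  -- inner sums: only `j = i ± 1` contribute
  have hinner : ∀ i ∈ Λ, ∑ j ∈ Λ, (if |j - i| = 1 then P.V ((τ i).1 - (τ j).1) else 0) ≤
      P.V ((τ i).1 - (τ (i - 1)).1) + P.V ((τ i).1 - (τ (i + 1)).1) := by
    intro i _
    rw [← Finset.sum_filter]
    have hsub : Λ.filter (fun j => |j - i| = 1) ⊆ ({i - 1, i + 1} : Finset ℤ) := by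
      intro j hj
      rw [Finset.mem_filter] at hj
      rw [Finset.mem_insert, Finset.mem_singleton]
      rcases abs_eq (zero_le_one' ℤ) |>.1 hj.2 with h | h <;> omega
    have hne : i - 1 ≠ i + 1 := by omega
    calc ∑ j ∈ Λ.filter (fun j => |j - i| = 1), P.V ((τ i).1 - (τ j).1)
        ≤ ∑ j ∈ ({i - 1, i + 1} : Finset ℤ), P.V ((τ i).1 - (τ j).1) :=
          Finset.sum_le_sum_of_subset_of_nonneg hsub fun j _ _ => hV0 _
      _ = P.V ((τ i).1 - (τ (i - 1)).1) + P.V ((τ i).1 - (τ (i + 1)).1) := Finset.sum_pair hne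
  have hΛB : Λ ⊆ sevBonds Λ := Finset.subset_union_left
  have hIB : Λ.image (fun i => i - 1) ⊆ sevBonds Λ := Finset.subset_union_right
  -- the two reindexed sums
  have h1 : ∑ i ∈ Λ, P.V ((τ i).1 - (τ (i + 1)).1) ≤ ∑ j ∈ sevBonds Λ, P.V ((τ (j + 1)).1 - (τ j).1) := by
    calc ∑ i ∈ Λ, P.V ((τ i).1 - (τ (i + 1)).1) = ∑ i ∈ Λ, P.V ((τ (i + 1)).1 - (τ i).1) :=
          Finset.sum_congr rfl fun i _ => by rw [← hVe, neg_sub]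
      _ ≤ ∑ j ∈ sevBonds Λ, P.V ((τ (j + 1)).1 - (τ j).1) :=
          Finset.sum_le_sum_of_subset_of_nonneg hΛB fun j _ _ => hV0 _
  have h2 : ∑ i ∈ Λ, P.V ((τ i).1 - (τ (i - 1)).1) ≤ ∑ j ∈ sevBonds Λ, P.V ((τ (j + 1)).1 - (τ j).1) := by
    have hinj : Set.InjOn (fun i : ℤ => i - 1) Λ := fun x _ y _ h => by simpa using h
    calc ∑ i ∈ Λ, P.V ((τ i).1 - (τ (i - 1)).1)
        = ∑ j ∈ Λ.image (fun i => i - 1), P.V ((τ (j + 1)).1 - (τ j).1) := by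
          rw [Finset.sum_image hinj]
          exact Finset.sum_congr rfl fun i _ => by rw [sub_add_cancel]
      _ ≤ ∑ j ∈ sevBonds Λ, P.V ((τ (j + 1)).1 - (τ j).1) :=
          Finset.sum_le_sum_of_subset_of_nonneg hIB fun j _ _ => hV0 _
  calc ∑ i ∈ Λ, ∑ j ∈ Λ, (if |j - i| = 1 then P.V ((τ i).1 - (τ j).1) else 0)
      ≤ ∑ i ∈ Λ, (P.V ((τ i).1 - (τ (i - 1)).1) + P.V ((τ i).1 - (τ (i + 1)).1)) :=
        Finset.sum_le_sum hinner
    _ = ∑ i ∈ Λ, P.V ((τ i).1 - (τ (i - 1)).1) + ∑ i ∈ Λ, P.V ((τ i).1 - (τ (i + 1)).1) :=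
        Finset.sum_add_distrib
    _ ≤ 2 * ∑ j ∈ sevBonds Λ, P.V ((τ (j + 1)).1 - (τ j).1) := by linarith

/-- **`W_{μ,n} ≤ 2 H_{Λ_{μ,n}} + (2n+1)`** on any configuration (`U, V ≥ 0`, `V` even). [folklore] -/
theorem bmLocalEnergy_le_two_mul_sevEnergy (hU0 : ∀ r, 0 ≤ P.U r) (hV0 : ∀ r, 0 ≤ P.V r)
    (hVe : ∀ r, P.V (-r) = P.V r) (μ : ℤ) (n : ℕ) (τ : ChainConfig) :
    P.bmLocalEnergy μ n τ ≤
      2 * ((∑ i ∈ Finset.Icc (μ - n) (μ + n), ((τ i).2 ^ 2 / 2 + P.U (τ i).1)) +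
        ∑ j ∈ sevBonds (Finset.Icc (μ - n) (μ + n)), P.V ((τ (j + 1)).1 - (τ j).1)) +
      (2 * (n : ℝ) + 1) := by
  unfold bmLocalEnergy
  set Λ := Finset.Icc (μ - n) (μ + n) with hΛ
  have hsite : ∑ i ∈ Λ, ((τ i).2 ^ 2 / 2 + P.U (τ i).1 + 1) =
      ∑ i ∈ Λ, ((τ i).2 ^ 2 / 2 + P.U (τ i).1) + (2 * (n : ℝ) + 1) := by
    rw [Finset.sum_add_distrib, Finset.sum_const, card_cbox, nsmul_eq_mul, mul_one]
    push_cast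
    ring
  have hnn : 0 ≤ ∑ i ∈ Λ, ((τ i).2 ^ 2 / 2 + P.U (τ i).1) :=
    Finset.sum_nonneg fun i _ => by have := hU0 (τ i).1; positivity
  have hpair := bmPair_le_two_mul_bonds hV0 hVe Λ τ
  rw [hsite]
  linarith

/-- **`H_{Λ_{μ,n}} ≤ W_{μ,n+1}`** on any configuration (`U, V ≥ 0`). [folklore] -/
theorem sevEnergy_le_bmLocalEnergy_succ (hU0 : ∀ r, 0 ≤ P.U r) (hV0 : ∀ r, 0 ≤ P.V r)
    (μ : ℤ) (n : ℕ) (τ : ChainConfig) :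
    (∑ i ∈ Finset.Icc (μ - n) (μ + n), ((τ i).2 ^ 2 / 2 + P.U (τ i).1)) +
        ∑ j ∈ sevBonds (Finset.Icc (μ - n) (μ + n)), P.V ((τ (j + 1)).1 - (τ j).1) ≤
      P.bmLocalEnergy μ (n + 1) τ := by
  unfold bmLocalEnergy
  set Λ := Finset.Icc (μ - n) (μ + n) with hΛ
  set Λ' := Finset.Icc (μ - (n + 1 : ℕ)) (μ + (n + 1 : ℕ)) with hΛ'
  have hsub : Λ ⊆ Λ' := cbox_subset (Nat.le_succ n)
  refine add_le_add ?_ ?_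
  · calc ∑ i ∈ Λ, ((τ i).2 ^ 2 / 2 + P.U (τ i).1)
        ≤ ∑ i ∈ Λ, ((τ i).2 ^ 2 / 2 + P.U (τ i).1 + 1) :=
          Finset.sum_le_sum fun i _ => by linarith
      _ ≤ ∑ i ∈ Λ', ((τ i).2 ^ 2 / 2 + P.U (τ i).1 + 1) :=
          Finset.sum_le_sum_of_subset_of_nonneg hsub fun i _ _ => by
            have := hU0 (τ i).1; positivity
  · -- bonds meeting `Λ` lie inside `Λ'`
    have hinj : Set.InjOn (fun j : ℤ => j + 1) (sevBonds Λ) := fun x _ y _ h => by simpa using h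
    have himg : (sevBonds Λ).image (fun j => j + 1) ⊆ Λ' := by
      intro i hi
      obtain ⟨j, hj, rfl⟩ := Finset.mem_image.1 hi
      have := sevBonds_cbox_subset μ n hj
      rw [Finset.mem_Icc] at this
      rw [hΛ', Finset.mem_Icc]; push_cast; omega
    have himg' : ∀ i ∈ (sevBonds Λ).image (fun j => j + 1), i - 1 ∈ Λ' := by
      intro i hi
      obtain ⟨j, hj, rfl⟩ := Finset.mem_image.1 hi
      have := sevBonds_cbox_subset μ n hj
      rw [Finset.mem_Icc] at this
      rw [hΛ', Finset.mem_Icc]; push_cast; omega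
    have hnn : ∀ i j : ℤ, (0 : ℝ) ≤ if |j - i| = 1 then P.V ((τ i).1 - (τ j).1) else 0 := by
      intro i j
      split_ifs
      · exact hV0 _
      · exact le_rfl
    calc ∑ j ∈ sevBonds Λ, P.V ((τ (j + 1)).1 - (τ j).1)
        = ∑ i ∈ (sevBonds Λ).image (fun j => j + 1), P.V ((τ i).1 - (τ (i - 1)).1) := by
          rw [Finset.sum_image hinj]
          exact Finset.sum_congr rfl fun j _ => by rw [add_sub_cancel_right]
      _ ≤ ∑ i ∈ (sevBonds Λ).image (fun j => j + 1),
            ∑ j ∈ Λ', (if |j - i| = 1 then P.V ((τ i).1 - (τ j).1) else 0) := by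
          refine Finset.sum_le_sum fun i hi => ?_
          have h := Finset.single_le_sum (f := fun j => if |j - i| = 1 then P.V ((τ i).1 - (τ j).1) else 0)
            (fun j _ => hnn i j) (himg' i hi)
          have e : |i - 1 - i| = 1 := by norm_num
          simpa [e] using h
      _ ≤ ∑ i ∈ Λ', ∑ j ∈ Λ', (if |j - i| = 1 then P.V ((τ i).1 - (τ j).1) else 0) :=
          Finset.sum_le_sum_of_subset_of_nonneg himg fun i _ _ =>
            Finset.sum_nonneg fun j _ => hnn i j

variable (hU : ContDiff ℝ 2 P.U) (hV : ContDiff ℝ 2 P.V) (hU0 : ∀ r, 0 ≤ P.U r)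
  (hV0 : ∀ r, 0 ≤ P.V r)

include hU0 hV0 in
/-- Single terms of the severed energy: `p_i²/2 ≤ H_Λ` and `U(q_i) ≤ H_Λ` for `i ∈ Λ`. [folklore] -/
theorem site_le_sevSum {Λ : Finset ℤ} (τ : ChainConfig) {i : ℤ} (hi : i ∈ Λ) :
    (τ i).2 ^ 2 / 2 ≤ (∑ i ∈ Λ, ((τ i).2 ^ 2 / 2 + P.U (τ i).1)) +
        ∑ j ∈ sevBonds Λ, P.V ((τ (j + 1)).1 - (τ j).1) ∧
      P.U (τ i).1 ≤ (∑ i ∈ Λ, ((τ i).2 ^ 2 / 2 + P.U (τ i).1)) +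
        ∑ j ∈ sevBonds Λ, P.V ((τ (j + 1)).1 - (τ j).1) := by
  have h1 : (τ i).2 ^ 2 / 2 + P.U (τ i).1 ≤ ∑ i ∈ Λ, ((τ i).2 ^ 2 / 2 + P.U (τ i).1) :=
    Finset.single_le_sum (f := fun i => (τ i).2 ^ 2 / 2 + P.U (τ i).1)
      (fun j _ => by have := hU0 (τ j).1; positivity) hi
  have h2 : 0 ≤ ∑ j ∈ sevBonds Λ, P.V ((τ (j + 1)).1 - (τ j).1) :=
    Finset.sum_nonneg fun j _ => hV0 _
  have h3 := hU0 (τ i).1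
  have h4 : 0 ≤ (τ i).2 ^ 2 / 2 := by positivity
  exact ⟨by linarith, by linarith⟩

include hU hV hU0 hV0 in
/-- **Energy bounds along the severed flow in a box.** For `γ t = T^Λ_t σ`, `Λ = Λ_{μ,n}`:
the severed energy `H_Λ(γ t)` equals `H_Λ(σ) ≤ W_{μ,n+1}(σ)`; hence for `i ∈ Λ`,
`p_i(t)²/2 ≤ W_{μ,n+1}(σ)` and `U(q_i(t)) ≤ W_{μ,n+1}(σ)`, for every bond `(j, j+1)` meeting `Λ`,
`V(q_{j+1}(t) - q_j(t)) ≤ W_{μ,n+1}(σ)`, and (for even `V`) `W_{μ,n}(γ t) ≤ 3 W_{μ,n+1}(σ)`.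
[cite: ButtaMarchioro2016, §3 eqs. (3.6)–(3.7)] -/
theorem severedFlow_energy_bounds (hB1 : P.CondB1) (hVe : ∀ r, P.V (-r) = P.V r) (μ : ℤ) (n : ℕ)
    (σ : ChainConfig) (t : ℝ) :
    (∀ i ∈ Finset.Icc (μ - n) (μ + n),
      (severedFlow hB1 (Finset.Icc (μ - n) (μ + n)) t σ i).2 ^ 2 / 2 ≤ P.bmLocalEnergy μ (n + 1) σ ∧
      P.U (severedFlow hB1 (Finset.Icc (μ - n) (μ + n)) t σ i).1 ≤ P.bmLocalEnergy μ (n + 1) σ) ∧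
    (∀ j ∈ sevBonds (Finset.Icc (μ - n) (μ + n)),
      P.V ((severedFlow hB1 (Finset.Icc (μ - n) (μ + n)) t σ (j + 1)).1 -
        (severedFlow hB1 (Finset.Icc (μ - n) (μ + n)) t σ j).1) ≤ P.bmLocalEnergy μ (n + 1) σ) ∧
    P.bmLocalEnergy μ n (severedFlow hB1 (Finset.Icc (μ - n) (μ + n)) t σ) ≤
      3 * P.bmLocalEnergy μ (n + 1) σ := by
  set Λ := Finset.Icc (μ - n) (μ + n) with hΛ
  set γ : ℝ → ChainConfig := fun t => severedFlow hB1 Λ t σ with hγ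
  have hsol : P.IsSeveredSolution Λ γ := isSeveredSolution_severedFlow hB1 Λ σ
  have hγ0 : γ 0 = σ := by simp [hγ]
  have hoff : ∀ t, ∀ j ∉ Λ, γ t j = σ j := fun t j hj => by
    have := hsol.2 j hj t; rwa [hγ0] at this
  have hcons := sevEnergy_eq_of_isSeveredSolution hU hV hsol t
  rw [hγ0] at hcons
  rw [sevEnergy_restrict_eq (hoff t), sevEnergy_restrict_eq (fun j _ => rfl)] at hcons
  have hE0 := sevEnergy_le_bmLocalEnergy_succ hU0 hV0 μ n σ
  refine ⟨fun i hi => ?_, fun j hj => ?_, ?_⟩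
  · have h := site_le_sevSum hU0 hV0 (γ t) hi
    rw [hcons] at h
    exact ⟨h.1.trans hE0, h.2.trans hE0⟩
  · have h1 : P.V ((γ t (j + 1)).1 - (γ t j).1) ≤
        ∑ j ∈ sevBonds Λ, P.V ((γ t (j + 1)).1 - (γ t j).1) :=
      Finset.single_le_sum (f := fun j => P.V ((γ t (j + 1)).1 - (γ t j).1)) (fun j _ => hV0 _) hj
    have h2 : 0 ≤ ∑ i ∈ Λ, ((γ t i).2 ^ 2 / 2 + P.U (γ t i).1) :=
      Finset.sum_nonneg fun i _ => by have := hU0 (γ t i).1; positivity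
    show P.V ((γ t (j + 1)).1 - (γ t j).1) ≤ P.bmLocalEnergy μ (n + 1) σ
    linarith
  · have h := bmLocalEnergy_le_two_mul_sevEnergy hU0 hV0 hVe μ n (γ t)
    rw [hcons] at h
    have h3 := card_le_bmLocalEnergy hU0 hV0 μ (n + 1) σ
    push_cast at h3
    show P.bmLocalEnergy μ n (γ t) ≤ 3 * P.bmLocalEnergy μ (n + 1) σ
    linarith

include hU hV hU0 hV0 in
/-- **Displacement bound along the severed flow**: for `i ∈ Λ_{μ,n}`,
`|q_i(t) - q_i(0)| ≤ |t| (2 W_{μ,n+1}(σ))^{1/2}` (mean value inequality with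
`|q̇_i| = |p_i| ≤ (2W)^{1/2}`). [cite: ButtaMarchioro2016, §3 eq. (3.8)] -/
theorem severedFlow_displacement_le (hB1 : P.CondB1) (hVe : ∀ r, P.V (-r) = P.V r) (μ : ℤ)
    (n : ℕ) (σ : ChainConfig) {i : ℤ} (hi : i ∈ Finset.Icc (μ - n) (μ + n)) (t : ℝ) :
    |(severedFlow hB1 (Finset.Icc (μ - n) (μ + n)) t σ i).1 - (σ i).1| ≤
      |t| * Real.sqrt (2 * P.bmLocalEnergy μ (n + 1) σ) := by
  set Λ := Finset.Icc (μ - n) (μ + n) with hΛ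
  have hsol : P.IsSeveredSolution Λ fun t => severedFlow hB1 Λ t σ :=
    isSeveredSolution_severedFlow hB1 Λ σ
  have hp : ∀ s, |(severedFlow hB1 Λ s σ i).2| ≤ Real.sqrt (2 * P.bmLocalEnergy μ (n + 1) σ) := by
    intro s
    have h := ((severedFlow_energy_bounds hU hV hU0 hV0 hB1 hVe μ n σ s).1 i hi).1
    rw [← Real.sqrt_sq_eq_abs]
    exact Real.sqrt_le_sqrt (by linarith)
  have key := (convex_univ).norm_image_sub_le_of_norm_hasDerivWithin_le
    (f := fun s => (severedFlow hB1 Λ s σ i).1) (f' := fun s => (severedFlow hB1 Λ s σ i).2)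
    (fun s _ => ((hsol.1 i hi s).1).hasDerivWithinAt)
    (fun s _ => by rw [Real.norm_eq_abs]; exact hp s) (mem_univ 0) (mem_univ t)
  simp only [Real.norm_eq_abs, sub_zero, severedFlow_zero] at key
  simpa [mul_comm] using key

end SeveredEnergy

/-! ### §4 The Dobrushin–Fritz iteration (BM §3, (3.4)–(3.9)) -/

section Calculus

/-- **Two-sided integration step**: if `g(0) = g'(0) = 0` and `|g''(s)| ≤ A |s|^j` for `|s| ≤ τ`,
then `|g'(t)| ≤ A |t|^{j+1}/(j+1)` and `|g(t)| ≤ A |t|^{j+2}/((j+1)(j+2))` for `|t| ≤ τ`: the one-sided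
step on `[0, τ]` (Mathlib's fencing theorem `image_norm_le_of_norm_deriv_right_le_deriv_boundary`, as
in the tree's proof of LLL Thm 2) applied to `g` and to `s ↦ g(-s)`. [folklore] -/
theorem abs_le_of_deriv_two_bound {g g' g'' : ℝ → ℝ} {τ A : ℝ} {j : ℕ}
    (hg : ∀ t, HasDerivAt g (g' t) t) (hg' : ∀ t, HasDerivAt g' (g'' t) t)
    (h0 : g 0 = 0) (h0' : g' 0 = 0) (hb : ∀ s, |s| ≤ τ → |g'' s| ≤ A * |s| ^ j) :
    ∀ t, |t| ≤ τ → |g' t| ≤ A * |t| ^ (j + 1) / (j + 1) ∧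
      |g t| ≤ A * |t| ^ (j + 2) / ((j + 1) * (j + 2)) := by
  -- the one-sided step on `[0, τ]`, for an arbitrary triple `(G, G', G'')`
  have one_sided : ∀ {G G' G'' : ℝ → ℝ}, (∀ t, HasDerivAt G (G' t) t) → (∀ t, HasDerivAt G' (G'' t) t) →
      G 0 = 0 → G' 0 = 0 → (∀ s ∈ Ico 0 τ, |G'' s| ≤ A * s ^ j) →
      ∀ t ∈ Icc 0 τ, |G' t| ≤ A * t ^ (j + 1) / (j + 1) ∧
        |G t| ≤ A * t ^ (j + 2) / ((j + 1) * (j + 2)) := by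
    intro G G' G'' hG hG' hG0 hG0' hbG
    have hj1 : (j + 1 : ℝ) ≠ 0 := by positivity
    have hj2 : (j + 2 : ℝ) ≠ 0 := by positivity
    have hB₁ : ∀ x, HasDerivAt (fun s => A * s ^ (j + 1) / (j + 1)) (A * x ^ j) x := fun x => by
      have h := ((hasDerivAt_pow (j + 1) x).const_mul A).div_const (j + 1 : ℝ)
      have e : A * (((j + 1 : ℕ) : ℝ) * x ^ (j + 1 - 1)) / (j + 1 : ℝ) = A * x ^ j := by
        rw [Nat.add_sub_cancel]; push_cast; field_simp
      rwa [e] at h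
    have hB₂ : ∀ x, HasDerivAt (fun s => A * s ^ (j + 2) / ((j + 1) * (j + 2)))
        (A * x ^ (j + 1) / (j + 1)) x := fun x => by
      have h := ((hasDerivAt_pow (j + 2) x).const_mul A).div_const ((j + 1 : ℝ) * (j + 2))
      have e : A * (((j + 2 : ℕ) : ℝ) * x ^ (j + 2 - 1)) / ((j + 1 : ℝ) * (j + 2)) =
          A * x ^ (j + 1) / (j + 1) := by
        rw [show j + 2 - 1 = j + 1 by omega]; push_cast; field_simp
      rwa [e] at h
    have step₁ : ∀ ⦃x⦄, x ∈ Icc 0 τ → ‖G' x‖ ≤ A * x ^ (j + 1) / (j + 1) :=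
      image_norm_le_of_norm_deriv_right_le_deriv_boundary
        (fun x _ => (hG' x).continuousAt.continuousWithinAt)
        (fun x _ => (hG' x).hasDerivWithinAt) (by simp [hG0']) hB₁
        (fun x hx => by rw [Real.norm_eq_abs]; exact hbG x hx)
    have step₂ : ∀ ⦃x⦄, x ∈ Icc 0 τ → ‖G x‖ ≤ A * x ^ (j + 2) / ((j + 1) * (j + 2)) :=
      image_norm_le_of_norm_deriv_right_le_deriv_boundary
        (fun x _ => (hG x).continuousAt.continuousWithinAt)
        (fun x _ => (hG x).hasDerivWithinAt) (by simp [hG0]) hB₂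
        (fun x hx => step₁ (Ico_subset_Icc_self hx))
    intro t ht
    exact ⟨by simpa [Real.norm_eq_abs] using step₁ ht, by simpa [Real.norm_eq_abs] using step₂ ht⟩
  intro t ht
  rcases le_or_gt 0 t with ht0 | ht0
  · -- `t ≥ 0`
    have h := one_sided hg hg' h0 h0'
      (fun s hs => by
        have := hb s (by rw [abs_of_nonneg hs.1]; exact hs.2.le.trans (le_abs_self τ |>.trans_eq
          (abs_of_nonneg (hs.1.trans hs.2.le))))
        rwa [abs_of_nonneg hs.1] at this) t ⟨ht0, (le_abs_self t).trans ht⟩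
    rwa [abs_of_nonneg ht0]
  · -- `t < 0`: reflect
    set G : ℝ → ℝ := fun s => g (-s) with hG
    set G' : ℝ → ℝ := fun s => -g' (-s) with hG'
    set G'' : ℝ → ℝ := fun s => g'' (-s) with hG''
    have hG1 : ∀ s, HasDerivAt G (G' s) s := fun s => by
      have h := (hg (-s)).comp s (hasDerivAt_neg s)
      simpa [hG, hG', Function.comp_def] using h
    have hG2 : ∀ s, HasDerivAt G' (G'' s) s := fun s => by
      have h := ((hg' (-s)).comp s (hasDerivAt_neg s)).fun_neg
      simpa [hG', hG'', Function.comp_def] using h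
    have hG0 : G 0 = 0 := by simp [hG, h0]
    have hG0' : G' 0 = 0 := by simp [hG', h0']
    have hbG : ∀ s ∈ Ico 0 τ, |G'' s| ≤ A * s ^ j := fun s hs => by
      have := hb (-s) (by rw [abs_neg, abs_of_nonneg hs.1]; exact hs.2.le)
      rwa [abs_neg, abs_of_nonneg hs.1] at this
    have h := one_sided hG1 hG2 hG0 hG0' hbG (-t)
      ⟨by linarith, by rw [abs_of_neg ht0] at ht; exact ht⟩
    simp only [hG, hG', neg_neg, abs_neg] at h
    rwa [abs_of_neg ht0]

variable {P : OscillatorChain}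

/-- Mean value step: if `|f''| ≤ ℓ` on `[-R, R]` then `f'` is `ℓ`-Lipschitz there. [folklore] -/
theorem abs_deriv_sub_deriv_le {f : ℝ → ℝ} (hf : ContDiff ℝ 2 f) {R ℓ : ℝ}
    (hℓ : ∀ a, |a| ≤ R → |deriv (deriv f) a| ≤ ℓ) {x y : ℝ} (hx : |x| ≤ R) (hy : |y| ≤ R) :
    |deriv f x - deriv f y| ≤ ℓ * |x - y| := by
  have hd : Differentiable ℝ (deriv f) := hf.differentiable_deriv_two
  have key := (convex_Icc (-R) R).norm_image_sub_le_of_norm_deriv_le (f := deriv f) (C := ℓ)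
    (𝕜 := ℝ) (fun a _ => (hd a)) (fun a ha => by
      rw [Real.norm_eq_abs]; exact hℓ a (abs_le.2 ⟨ha.1, ha.2⟩)) (abs_le.1 hy) (abs_le.1 hx)
  simpa [Real.norm_eq_abs] using key

/-- **Lipschitz bound for the force between two configurations** (BM (3.4)–(3.5); LLL (12b)):
if `|U''(a)| ≤ C_U (1+|a|)^{2m₁}`, `|V''(r)| ≤ C_V (1+|r|)^{2m₂}`, the positions at site `i` are
bounded by `ρ_U`, the two bond elongations at `i` by `ρ_V` (both configurations), and the positions at
`i-1, i, i+1` differ by at most `δ`, then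
`|F_i(σ₁) - F_i(σ₂)| ≤ (C_U (1+ρ_U)^{2m₁} + 4 C_V (1+ρ_V)^{2m₂}) δ`. [cite: ButtaMarchioro2016, §3 eqs. (3.4)–(3.5)] -/
theorem force_sub_force_le (hU : ContDiff ℝ 2 P.U) (hV : ContDiff ℝ 2 P.V) {CU CV : ℝ} {m₁ m₂ : ℕ}
    (hCU : 0 ≤ CU) (hCV : 0 ≤ CV)
    (hgU : ∀ a, |deriv (deriv P.U) a| ≤ CU * (1 + |a|) ^ (2 * m₁))
    (hgV : ∀ r, |deriv (deriv P.V) r| ≤ CV * (1 + |r|) ^ (2 * m₂))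
    {ρU ρV δ : ℝ} (hρU0 : 0 ≤ ρU) (hρV0 : 0 ≤ ρV) {σ₁ σ₂ : ChainConfig} {i : ℤ}
    (hq₁ : |(σ₁ i).1| ≤ ρU) (hq₂ : |(σ₂ i).1| ≤ ρU)
    (hb₁ : |(σ₁ (i + 1)).1 - (σ₁ i).1| ≤ ρV) (hb₁' : |(σ₁ i).1 - (σ₁ (i - 1)).1| ≤ ρV)
    (hb₂ : |(σ₂ (i + 1)).1 - (σ₂ i).1| ≤ ρV) (hb₂' : |(σ₂ i).1 - (σ₂ (i - 1)).1| ≤ ρV)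
    (hδ : ∀ j, i - 1 ≤ j → j ≤ i + 1 → |(σ₁ j).1 - (σ₂ j).1| ≤ δ) :
    |P.force σ₁ i - P.force σ₂ i| ≤ (CU * (1 + ρU) ^ (2 * m₁) + 4 * CV * (1 + ρV) ^ (2 * m₂)) * δ := by
  set ℓU := CU * (1 + ρU) ^ (2 * m₁) with hℓU
  set ℓV := CV * (1 + ρV) ^ (2 * m₂) with hℓV
  have hℓU0 : 0 ≤ ℓU := by positivity
  have hℓV0 : 0 ≤ ℓV := by positivity
  have LU : ∀ x y : ℝ, |x| ≤ ρU → |y| ≤ ρU → |deriv P.U x - deriv P.U y| ≤ ℓU * |x - y| :=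
    fun x y hx hy => abs_deriv_sub_deriv_le hU
      (fun a ha => (hgU a).trans (by rw [hℓU]; gcongr)) hx hy
  have LV : ∀ x y : ℝ, |x| ≤ ρV → |y| ≤ ρV → |deriv P.V x - deriv P.V y| ≤ ℓV * |x - y| :=
    fun x y hx hy => abs_deriv_sub_deriv_le hV
      (fun a ha => (hgV a).trans (by rw [hℓV]; gcongr)) hx hy
  have d0 := hδ i (by linarith) (by linarith)
  have dp := hδ (i + 1) (by linarith) le_rfl
  have dm := hδ (i - 1) le_rfl (by linarith)
  have hδ0 : 0 ≤ δ := (abs_nonneg _).trans d0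
  have t1 : |deriv P.U (σ₁ i).1 - deriv P.U (σ₂ i).1| ≤ ℓU * δ :=
    (LU _ _ hq₁ hq₂).trans (mul_le_mul_of_nonneg_left d0 hℓU0)
  have t2 : |deriv P.V ((σ₁ (i + 1)).1 - (σ₁ i).1) - deriv P.V ((σ₂ (i + 1)).1 - (σ₂ i).1)| ≤
      ℓV * (2 * δ) := by
    refine (LV _ _ hb₁ hb₂).trans (mul_le_mul_of_nonneg_left ?_ hℓV0)
    calc |(σ₁ (i + 1)).1 - (σ₁ i).1 - ((σ₂ (i + 1)).1 - (σ₂ i).1)|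
        = |((σ₁ (i + 1)).1 - (σ₂ (i + 1)).1) - ((σ₁ i).1 - (σ₂ i).1)| := by ring_nf
      _ ≤ |(σ₁ (i + 1)).1 - (σ₂ (i + 1)).1| + |(σ₁ i).1 - (σ₂ i).1| := abs_sub _ _
      _ ≤ δ + δ := add_le_add dp d0
      _ = 2 * δ := by ring
  have t3 : |deriv P.V ((σ₁ i).1 - (σ₁ (i - 1)).1) - deriv P.V ((σ₂ i).1 - (σ₂ (i - 1)).1)| ≤
      ℓV * (2 * δ) := by
    refine (LV _ _ hb₁' hb₂').trans (mul_le_mul_of_nonneg_left ?_ hℓV0)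
    calc |(σ₁ i).1 - (σ₁ (i - 1)).1 - ((σ₂ i).1 - (σ₂ (i - 1)).1)|
        = |((σ₁ i).1 - (σ₂ i).1) - ((σ₁ (i - 1)).1 - (σ₂ (i - 1)).1)| := by ring_nf
      _ ≤ |(σ₁ i).1 - (σ₂ i).1| + |(σ₁ (i - 1)).1 - (σ₂ (i - 1)).1| := abs_sub _ _
      _ ≤ δ + δ := add_le_add d0 dm
      _ = 2 * δ := by ring
  rw [force_eq, force_eq]
  calc |-deriv P.U (σ₁ i).1 + deriv P.V ((σ₁ (i + 1)).1 - (σ₁ i).1) -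
          deriv P.V ((σ₁ i).1 - (σ₁ (i - 1)).1) -
        (-deriv P.U (σ₂ i).1 + deriv P.V ((σ₂ (i + 1)).1 - (σ₂ i).1) -
          deriv P.V ((σ₂ i).1 - (σ₂ (i - 1)).1))|
      = |-(deriv P.U (σ₁ i).1 - deriv P.U (σ₂ i).1) +
          (deriv P.V ((σ₁ (i + 1)).1 - (σ₁ i).1) - deriv P.V ((σ₂ (i + 1)).1 - (σ₂ i).1)) -
          (deriv P.V ((σ₁ i).1 - (σ₁ (i - 1)).1) - deriv P.V ((σ₂ i).1 - (σ₂ (i - 1)).1))| := by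
        ring_nf
    _ ≤ |-(deriv P.U (σ₁ i).1 - deriv P.U (σ₂ i).1) +
          (deriv P.V ((σ₁ (i + 1)).1 - (σ₁ i).1) - deriv P.V ((σ₂ (i + 1)).1 - (σ₂ i).1))| +
          |deriv P.V ((σ₁ i).1 - (σ₁ (i - 1)).1) - deriv P.V ((σ₂ i).1 - (σ₂ (i - 1)).1)| :=
        abs_sub _ _
    _ ≤ |deriv P.U (σ₁ i).1 - deriv P.U (σ₂ i).1| +
          |deriv P.V ((σ₁ (i + 1)).1 - (σ₁ i).1) - deriv P.V ((σ₂ (i + 1)).1 - (σ₂ i).1)| +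
          |deriv P.V ((σ₁ i).1 - (σ₁ (i - 1)).1) - deriv P.V ((σ₂ i).1 - (σ₂ (i - 1)).1)| := by
        gcongr
        exact (abs_add_le _ _).trans (by rw [abs_neg])
    _ ≤ ℓU * δ + ℓV * (2 * δ) + ℓV * (2 * δ) := add_le_add (add_le_add t1 t2) t3
    _ = (CU * (1 + ρU) ^ (2 * m₁) + 4 * CV * (1 + ρV) ^ (2 * m₂)) * δ := by rw [hℓU, hℓV]; ring

/-- From `(1+ρ)^{2s} ≤ Z` with `Z ≥ 1` and `m/s ≤ η ≤ 1`: `(1+ρ)^{2m} ≤ Z^η`. [folklore] -/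
theorem pow_le_rpow_of_pow_le {ρ Z η : ℝ} {s m : ℕ} (hs : 1 ≤ s) (hρ : 0 ≤ ρ) (hZ : 1 ≤ Z)
    (h : (1 + ρ) ^ (2 * s) ≤ Z) (hm : (m : ℝ) / s ≤ η) : (1 + ρ) ^ (2 * m) ≤ Z ^ η := by
  have hs0 : (0 : ℝ) < s := by exact_mod_cast hs
  have hbase : 0 ≤ 1 + ρ := by positivity
  have h1 : ((1 + ρ) ^ (2 * s)) ^ ((m : ℝ) / s) = (1 + ρ) ^ (2 * m) := by
    rw [← Real.rpow_natCast (1 + ρ) (2 * s), ← Real.rpow_mul hbase]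
    have : ((2 * s : ℕ) : ℝ) * ((m : ℝ) / s) = ((2 * m : ℕ) : ℝ) := by
      push_cast
      field_simp
    rw [this, Real.rpow_natCast]
  calc (1 + ρ) ^ (2 * m) = ((1 + ρ) ^ (2 * s)) ^ ((m : ℝ) / s) := h1.symm
    _ ≤ Z ^ ((m : ℝ) / s) := Real.rpow_le_rpow (by positivity) h (by positivity)
    _ ≤ Z ^ η := Real.rpow_le_rpow_of_exponent_le hZ hm

/-- `Z^η ≤ Z` for `Z ≥ 1`, `η ≤ 1`. [folklore] -/
theorem rpow_le_self_of_one_le {Z η : ℝ} (hZ : 1 ≤ Z) (hη : η ≤ 1) : Z ^ η ≤ Z := by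
  calc Z ^ η ≤ Z ^ (1 : ℝ) := Real.rpow_le_rpow_of_exponent_le hZ hη
    _ = Z := Real.rpow_one Z

/-- `|q| ≤ ρ` from `(1+|q|)^{2s} ≤ (1+ρ)^{2s}`. [folklore] -/
theorem abs_le_of_pow_le {q ρ : ℝ} {s : ℕ} (hs : 1 ≤ s) (hρ : 0 ≤ ρ)
    (h : (1 + |q|) ^ (2 * s) ≤ (1 + ρ) ^ (2 * s)) : |q| ≤ ρ := by
  have h2s : 2 * s ≠ 0 := by omega
  have := (pow_le_pow_iff_left₀ (by positivity) (by positivity) h2s).1 h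
  linarith

end Calculus

section Engine

variable {P : OscillatorChain}

/-- **The Dobrushin–Fritz iteration for two curves solving the equations of motion in a box**
(BM §3, from (3.3) to (3.9); LLL 1977 proof of Thm 2). Let `γ₁, γ₂` solve the equations of motion
at every site of `Λ_{ν,n}` (for all times), agree at time `0` on `Λ_{ν,n}`, have force differences
controlled by `Θ` times the maximal position difference over neighbours (for `|s| ≤ t`), and
position differences bounded by `D` on `Λ_{ν,n+1}` for `|s| ≤ t`. Then after `d` iterations, for
`k + d = n + 1`, `i ∈ Λ_{ν,k}`, `|s| ≤ t`:
`|Δq_i(s)| ≤ D Θ^d |s|^{2d}/(2d)!` and (for `d ≥ 1`) `|Δp_i(s)| ≤ D Θ^d |s|^{2d-1}/(2d-1)!`.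
[cite: ButtaMarchioro2016, §3 eqs. (3.3)–(3.9)] -/
theorem df_iterate {γ₁ γ₂ : ℝ → ChainConfig} {ν : ℤ} {n : ℕ} {t Θ D : ℝ}
    (h₁ : ∀ i ∈ Finset.Icc (ν - n) (ν + n), ∀ s, HasDerivAt (fun s => (γ₁ s i).1) (γ₁ s i).2 s ∧
      HasDerivAt (fun s => (γ₁ s i).2) (P.force (γ₁ s) i) s)
    (h₂ : ∀ i ∈ Finset.Icc (ν - n) (ν + n), ∀ s, HasDerivAt (fun s => (γ₂ s i).1) (γ₂ s i).2 s ∧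
      HasDerivAt (fun s => (γ₂ s i).2) (P.force (γ₂ s) i) s)
    (h0 : ∀ i ∈ Finset.Icc (ν - n) (ν + n), γ₁ 0 i = γ₂ 0 i)
    (hLip : ∀ s, |s| ≤ t → ∀ i ∈ Finset.Icc (ν - n) (ν + n), ∀ δ : ℝ,
      (∀ j, i - 1 ≤ j → j ≤ i + 1 → |(γ₁ s j).1 - (γ₂ s j).1| ≤ δ) →
        |P.force (γ₁ s) i - P.force (γ₂ s) i| ≤ Θ * δ)
    (hD : ∀ s, |s| ≤ t → ∀ j ∈ Finset.Icc (ν - (n + 1 : ℕ)) (ν + (n + 1 : ℕ)),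
      |(γ₁ s j).1 - (γ₂ s j).1| ≤ D) :
    ∀ d k : ℕ, k + d = n + 1 → ∀ i ∈ Finset.Icc (ν - k) (ν + k), ∀ s, |s| ≤ t →
      |(γ₁ s i).1 - (γ₂ s i).1| ≤ D * Θ ^ d * |s| ^ (2 * d) / (2 * d).factorial ∧
      (1 ≤ d → |(γ₁ s i).2 - (γ₂ s i).2| ≤
        D * Θ ^ d * |s| ^ (2 * d - 1) / (2 * d - 1).factorial) := by
  intro d
  induction d with
  | zero =>
    intro k hk i hi s hs
    refine ⟨?_, fun h => absurd h (by norm_num)⟩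
    have hk' : k = n + 1 := by omega
    subst hk'
    simpa using hD s hs i hi
  | succ d ih =>
    intro k hk i hi s hs
    have hkn : k ≤ n := by omega
    have hiΛ : i ∈ Finset.Icc (ν - n) (ν + n) := cbox_subset hkn hi
    -- induction hypothesis at level `k + 1`
    have ih' := ih (k + 1) (by omega)
    have hnb : ∀ j, i - 1 ≤ j → j ≤ i + 1 → j ∈ Finset.Icc (ν - (k + 1 : ℕ)) (ν + (k + 1 : ℕ)) := by
      intro j hj1 hj2
      rw [Finset.mem_Icc] at hi ⊢; push_cast; omega
    -- the second derivative of `Δq_i` is bounded by `Θ · DΘ^d |s|^{2d}/(2d)!`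
    set A : ℝ := D * Θ ^ (d + 1) / (2 * d).factorial with hA
    have hg : ∀ s, HasDerivAt (fun s => (γ₁ s i).1 - (γ₂ s i).1) ((γ₁ s i).2 - (γ₂ s i).2) s :=
      fun s => (h₁ i hiΛ s).1.sub (h₂ i hiΛ s).1
    have hg' : ∀ s, HasDerivAt (fun s => (γ₁ s i).2 - (γ₂ s i).2)
        (P.force (γ₁ s) i - P.force (γ₂ s) i) s := fun s => (h₁ i hiΛ s).2.sub (h₂ i hiΛ s).2
    have hq0 : (γ₁ 0 i).1 - (γ₂ 0 i).1 = 0 := by rw [h0 i hiΛ]; ring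
    have hp0 : (γ₁ 0 i).2 - (γ₂ 0 i).2 = 0 := by rw [h0 i hiΛ]; ring
    have hb : ∀ r, |r| ≤ t → |P.force (γ₁ r) i - P.force (γ₂ r) i| ≤ A * |r| ^ (2 * d) := by
      intro r hr
      have h := hLip r hr i hiΛ (D * Θ ^ d * |r| ^ (2 * d) / (2 * d).factorial) (fun j hj1 hj2 =>
        (ih' j (hnb j hj1 hj2) r hr).1)
      calc |P.force (γ₁ r) i - P.force (γ₂ r) i|
          ≤ Θ * (D * Θ ^ d * |r| ^ (2 * d) / (2 * d).factorial) := h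
        _ = A * |r| ^ (2 * d) := by rw [hA]; ring
    have key := abs_le_of_deriv_two_bound hg hg' hq0 hp0 hb s hs
    have hfac1 : ((2 * d + 1).factorial : ℝ) = (2 * d).factorial * (2 * d + 1) := by
      rw [Nat.factorial_succ]; push_cast; ring
    have hfac2 : ((2 * d + 2).factorial : ℝ) = (2 * d).factorial * (2 * d + 1) * (2 * d + 2) := by
      rw [show 2 * d + 2 = (2 * d + 1) + 1 by ring, Nat.factorial_succ, Nat.factorial_succ]
      push_cast; ring
    have hf0 : ((2 * d).factorial : ℝ) ≠ 0 := by positivity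
    refine ⟨?_, fun _ => ?_⟩
    · calc |(γ₁ s i).1 - (γ₂ s i).1| ≤ A * |s| ^ (2 * d + 2) / ((↑(2 * d) + 1) * (↑(2 * d) + 2)) :=
            key.2
        _ = D * Θ ^ (d + 1) * |s| ^ (2 * (d + 1)) / (2 * (d + 1)).factorial := by
            rw [hA, show 2 * (d + 1) = 2 * d + 2 by ring, hfac2]
            push_cast
            field_simp
    · calc |(γ₁ s i).2 - (γ₂ s i).2| ≤ A * |s| ^ (2 * d + 1) / (↑(2 * d) + 1) := key.1
        _ = D * Θ ^ (d + 1) * |s| ^ (2 * (d + 1) - 1) / (2 * (d + 1) - 1).factorial := by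
            rw [hA, show 2 * (d + 1) - 1 = 2 * d + 1 by omega, hfac1]
            push_cast
            field_simp

end Engine

/-! ### §5 The arithmetic of BM's summability claim (3.10)–(3.13) -/

section Arith

/-- `1/(2d)! ≤ (e²/4)^d / d^{2d}` (from `x^n/n! ≤ e^x` at `x = n = 2d`; replaces Stirling's
formula in BM (3.9)). [folklore] -/
theorem inv_factorial_two_mul_le (d : ℕ) (hd : 1 ≤ d) :
    (1 : ℝ) / (2 * d).factorial ≤ (Real.exp 1 ^ 2 / 4) ^ d / (d : ℝ) ^ (2 * d) := by
  have hd0 : (0 : ℝ) < d := by exact_mod_cast hd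
  have h := Real.pow_div_factorial_le_exp (2 * (d : ℝ)) (by positivity) (2 * d)
  -- `(2d)^{2d}/(2d)! ≤ e^{2d}`
  have hfac : (0 : ℝ) < (2 * d).factorial := by positivity
  have hpow : (0 : ℝ) < (2 * (d : ℝ)) ^ (2 * d) := by positivity
  rw [div_le_iff₀ hfac] at h
  rw [div_le_div_iff₀ hfac (by positivity), one_mul]
  have he : Real.exp (2 * (d : ℝ)) = (Real.exp 1 ^ 2) ^ d := by
    rw [← Real.exp_nat_mul, ← Real.exp_nat_mul]; congr 1; push_cast; ring
  have h4 : (2 * (d : ℝ)) ^ (2 * d) = 4 ^ d * (d : ℝ) ^ (2 * d) := by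
    rw [mul_pow, pow_mul]; norm_num
  calc ((d : ℝ) ^ (2 * d)) = (2 * (d : ℝ)) ^ (2 * d) / 4 ^ d := by
        rw [h4]; field_simp
    _ ≤ Real.exp (2 * (d : ℝ)) * (2 * d).factorial / 4 ^ d :=
        div_le_div_of_nonneg_right h (by positivity)
    _ = (Real.exp 1 ^ 2 / 4) ^ d * (2 * d).factorial := by
        rw [he, div_pow]; ring

/-- `t · t^{2d} ≤ (t²(1+t^{β'}))^d` for `t ≥ 0`, `β' > 0`, `d β' ≥ 1`. [cite: ButtaMarchioro2016, §3 after eq. (3.11)] -/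
theorem mul_pow_two_mul_le {t β' : ℝ} (ht : 0 ≤ t) {d : ℕ} (hd : 1 ≤ (d : ℝ) * β') :
    t * t ^ (2 * d) ≤ (t ^ 2 * (1 + t ^ β')) ^ d := by
  have htb : 0 ≤ t ^ β' := Real.rpow_nonneg ht β'
  rcases le_or_gt t 1 with h1 | h1
  · calc t * t ^ (2 * d) ≤ 1 * t ^ (2 * d) := mul_le_mul_of_nonneg_right h1 (by positivity)
      _ = (t ^ 2) ^ d * 1 := by rw [one_mul, mul_one, pow_mul]
      _ ≤ (t ^ 2) ^ d * (1 + t ^ β') ^ d :=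
          mul_le_mul_of_nonneg_left (one_le_pow₀ (by linarith)) (by positivity)
      _ = (t ^ 2 * (1 + t ^ β')) ^ d := by rw [mul_pow]
  · have ht0 : 0 < t := one_pos.trans h1
    have hexp : ((2 * d + 1 : ℕ) : ℝ) ≤ (2 + β') * d := by push_cast; nlinarith
    calc t * t ^ (2 * d) = t ^ (2 * d + 1) := by ring
      _ = t ^ ((2 * d + 1 : ℕ) : ℝ) := (Real.rpow_natCast t (2 * d + 1)).symm
      _ ≤ t ^ ((2 + β') * d) := Real.rpow_le_rpow_of_exponent_le h1.le hexp
      _ = (t ^ (2 + β')) ^ d := by rw [Real.rpow_mul ht, Real.rpow_natCast]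
      _ = (t ^ 2 * t ^ β') ^ d := by
          rw [Real.rpow_add ht0, Real.rpow_two]
      _ ≤ (t ^ 2 * (1 + t ^ β')) ^ d := by
          apply pow_le_pow_left₀ (by positivity)
          exact mul_le_mul_of_nonneg_left (by linarith) (by positivity)

/-- `√Y · (Y^η)^d ≤ (Y^γ)^d` for `Y ≥ 1` and `d(γ - η) ≥ 1/2`. [cite: ButtaMarchioro2016, §3 after eq. (3.11)] -/
theorem sqrt_mul_rpow_pow_le {Y η γ : ℝ} (hY : 1 ≤ Y) {d : ℕ} (hd : 1 / 2 ≤ (d : ℝ) * (γ - η)) :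
    Real.sqrt Y * (Y ^ η) ^ d ≤ (Y ^ γ) ^ d := by
  have hY0 : 0 < Y := one_pos.trans_le hY
  rw [Real.sqrt_eq_rpow, ← Real.rpow_natCast (Y ^ η) d, ← Real.rpow_mul hY0.le,
    ← Real.rpow_add hY0, ← Real.rpow_natCast (Y ^ γ) d, ← Real.rpow_mul hY0.le]
  exact Real.rpow_le_rpow_of_exponent_le hY (by nlinarith)

/-- `(a + b)^γ ≤ 2^γ (a^γ + b^γ)` for `a, b ≥ 0`, `γ ≥ 0`. [folklore] -/
theorem add_rpow_le_two_rpow_mul {a b γ : ℝ} (ha : 0 ≤ a) (hb : 0 ≤ b) (hγ : 0 ≤ γ) :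
    (a + b) ^ γ ≤ 2 ^ γ * (a ^ γ + b ^ γ) := by
  have hmax : a + b ≤ 2 * max a b := by
    rcases le_total a b with h | h
    · rw [max_eq_right h]; linarith
    · rw [max_eq_left h]; linarith
  have hm0 : 0 ≤ max a b := le_max_of_le_left ha
  calc (a + b) ^ γ ≤ (2 * max a b) ^ γ := Real.rpow_le_rpow (by positivity) hmax hγ
    _ = 2 ^ γ * (max a b) ^ γ := Real.mul_rpow (by norm_num) hm0
    _ ≤ 2 ^ γ * (a ^ γ + b ^ γ) := by
        refine mul_le_mul_of_nonneg_left ?_ (by positivity)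
        rcases le_total a b with h | h
        · rw [max_eq_right h]; linarith [Real.rpow_nonneg ha γ]
        · rw [max_eq_left h]; linarith [Real.rpow_nonneg hb γ]

/-- **BM's summability arithmetic** ((3.10)–(3.13), `d = 1`). For constants `K₁ ≥ 0`,
`0 ≤ η < γ < 2`, `β' > 0` there is `A ≥ 1` such that whenever `Q, L' ≥ 1`, `t ≥ 0`,
`1 ≤ Y ≤ 18 Q (d + L')` and `d ≥ A (1 + t²(1+t^{β'}) Q^γ)^{1/(2-γ)} L'`, the iterated bound
`2√2 t √Y (K₁ Y^η)^d t^{2d}/(2d)!` is at most `64^{-d}` (any fixed geometric rate can be had by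
enlarging `A`; `1/64` leaves room for the polynomial prefactors met later). [cite: ButtaMarchioro2016, §3 eqs. (3.10)–(3.13)] -/
theorem bm_arith {K₁ η γ β' : ℝ} (hK₁ : 0 ≤ K₁) (hη0 : 0 ≤ η) (hηγ : η < γ) (hγ2 : γ < 2)
    (hβ' : 0 < β') :
    ∃ A : ℝ, 1 ≤ A ∧ ∀ (Q L' t Y : ℝ) (d : ℕ), 1 ≤ Q → 1 ≤ L' → 0 ≤ t → 1 ≤ Y →
      Y ≤ 18 * Q * (d + L') →
      A * (1 + t ^ 2 * (1 + t ^ β') * Q ^ γ) ^ (1 / (2 - γ)) * L' ≤ d →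
      2 * Real.sqrt 2 * t * Real.sqrt Y * (K₁ * Y ^ η) ^ d * t ^ (2 * d) / (2 * d).factorial ≤
        (1 / 64) ^ d := by
  have hγ0 : 0 < γ := hη0.trans_lt hηγ
  have h2γ : 0 < 2 - γ := by linarith
  -- the constants
  set K₂ : ℝ := 2 * Real.sqrt 2 * K₁ * (Real.exp 1 ^ 2 / 4) with hK₂
  have hK₂0 : 0 ≤ K₂ := by positivity
  set C₀ : ℝ := K₂ * 36 ^ γ with hC₀
  have hC₀0 : 0 ≤ C₀ := by positivity
  set A : ℝ := max (max (max 1 (1 / β')) (1 / (2 * (γ - η))))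
    (max ((128 * C₀ + 1) ^ (1 / (2 - γ))) (Real.sqrt (128 * C₀ + 1))) with hA
  have hA1 : 1 ≤ A := le_max_of_le_left (le_max_of_le_left (le_max_left _ _))
  have hA0 : 0 < A := one_pos.trans_le hA1
  have hAβ : 1 / β' ≤ A := le_max_of_le_left (le_max_of_le_left (le_max_right _ _))
  have hAγη : 1 / (2 * (γ - η)) ≤ A := le_max_of_le_left (le_max_right _ _)
  have hApow : (128 * C₀ + 1) ^ (1 / (2 - γ)) ≤ A := le_max_of_le_right (le_max_left _ _)
  have hAsq : Real.sqrt (128 * C₀ + 1) ≤ A := le_max_of_le_right (le_max_right _ _)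
  -- `A^{2-γ} ≥ 128 C₀ + 1` and `A² ≥ 128 C₀ + 1`
  have hA2γ : 128 * C₀ + 1 ≤ A ^ (2 - γ) := by
    have h := Real.rpow_le_rpow (by positivity) hApow h2γ.le
    rwa [← Real.rpow_mul (by positivity), one_div_mul_cancel h2γ.ne', Real.rpow_one] at h
  have hA2 : 128 * C₀ + 1 ≤ A ^ 2 := by
    have h := pow_le_pow_left₀ (Real.sqrt_nonneg _) hAsq 2
    rwa [Real.sq_sqrt (by positivity)] at h
  refine ⟨A, hA1, fun Q L' t Y d hQ hL' ht hY hYle hd => ?_⟩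
  -- notation
  set τ : ℝ := t ^ 2 * (1 + t ^ β') with hτ
  have htb : 0 ≤ t ^ β' := Real.rpow_nonneg ht β'
  have hτ0 : 0 ≤ τ := by positivity
  have hQ0 : 0 < Q := one_pos.trans_le hQ
  have hQγ : 0 ≤ Q ^ γ := Real.rpow_nonneg hQ0.le γ
  set B : ℝ := 1 + τ * Q ^ γ with hB
  have hB1 : 1 ≤ B := by rw [hB]; nlinarith
  have hB0 : 0 < B := one_pos.trans_le hB1
  set X : ℝ := B ^ (1 / (2 - γ)) with hX
  have hX1 : 1 ≤ X := Real.one_le_rpow hB1 (by positivity)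
  have hX0 : 0 < X := one_pos.trans_le hX1
  have hXpow : X ^ (2 - γ) = B := by
    rw [hX, ← Real.rpow_mul hB0.le, one_div_mul_cancel h2γ.ne', Real.rpow_one]
  -- `d ≥ A X L' ≥ A ≥ 1`
  have hAXL : A * X * L' ≤ d := hd
  have hAd : A ≤ d := by
    calc A = A * 1 * 1 := by ring
      _ ≤ A * X * L' := by gcongr
      _ ≤ d := hAXL
  have hd1 : (1 : ℝ) ≤ d := hA1.trans hAd
  have hd0 : (0 : ℝ) < d := one_pos.trans_le hd1
  have hdn : 1 ≤ d := by exact_mod_cast hd1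
  have hdβ : 1 ≤ (d : ℝ) * β' := by
    have : 1 / β' ≤ d := hAβ.trans hAd
    rwa [div_le_iff₀ hβ', ] at this
  have hdγη : 1 / 2 ≤ (d : ℝ) * (γ - η) := by
    have hpos : 0 < 2 * (γ - η) := by linarith
    have : 1 / (2 * (γ - η)) ≤ d := hAγη.trans hAd
    rw [div_le_iff₀ hpos] at this
    linarith
  have hY0 : 0 < Y := one_pos.trans_le hY
  -- Step 1–4: `b ≤ (K₂ τ Y^γ / d²)^d`
  have hstep : 2 * Real.sqrt 2 * t * Real.sqrt Y * (K₁ * Y ^ η) ^ d * t ^ (2 * d) /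
      (2 * d).factorial ≤ (K₂ * τ * Y ^ γ / (d : ℝ) ^ 2) ^ d := by
    have hfac := inv_factorial_two_mul_le d hdn
    have hA3 := mul_pow_two_mul_le ht hdβ
    have hA4 := sqrt_mul_rpow_pow_le (η := η) (γ := γ) hY hdγη
    have hnum : 0 ≤ 2 * Real.sqrt 2 * t * Real.sqrt Y * (K₁ * Y ^ η) ^ d * t ^ (2 * d) := by
      have : 0 ≤ Y ^ η := Real.rpow_nonneg hY0.le η
      positivity
    calc 2 * Real.sqrt 2 * t * Real.sqrt Y * (K₁ * Y ^ η) ^ d * t ^ (2 * d) / (2 * d).factorial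
        = 2 * Real.sqrt 2 * t * Real.sqrt Y * (K₁ * Y ^ η) ^ d * t ^ (2 * d) *
            (1 / (2 * d).factorial) := by ring
      _ ≤ 2 * Real.sqrt 2 * t * Real.sqrt Y * (K₁ * Y ^ η) ^ d * t ^ (2 * d) *
            ((Real.exp 1 ^ 2 / 4) ^ d / (d : ℝ) ^ (2 * d)) :=
          mul_le_mul_of_nonneg_left hfac hnum
      _ = 2 * Real.sqrt 2 * (t * t ^ (2 * d)) * (Real.sqrt Y * (Y ^ η) ^ d) *
            (K₁ ^ d * (Real.exp 1 ^ 2 / 4) ^ d / (d : ℝ) ^ (2 * d)) := by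
          rw [mul_pow]; ring
      _ ≤ 2 * Real.sqrt 2 * τ ^ d * (Y ^ γ) ^ d *
            (K₁ ^ d * (Real.exp 1 ^ 2 / 4) ^ d / (d : ℝ) ^ (2 * d)) := by
          have h1 : 0 ≤ Real.sqrt Y * (Y ^ η) ^ d := by
            have : 0 ≤ Y ^ η := Real.rpow_nonneg hY0.le η
            positivity
          have h2 : 0 ≤ K₁ ^ d * (Real.exp 1 ^ 2 / 4) ^ d / (d : ℝ) ^ (2 * d) := by positivity
          gcongr
      _ ≤ (2 * Real.sqrt 2) ^ d * τ ^ d * (Y ^ γ) ^ d *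
            (K₁ ^ d * (Real.exp 1 ^ 2 / 4) ^ d / (d : ℝ) ^ (2 * d)) := by
          have h22 : (1 : ℝ) ≤ 2 * Real.sqrt 2 := by
            have := Real.one_lt_sqrt_two
            linarith
          have hYγ : 0 ≤ (Y ^ γ) ^ d := pow_nonneg (Real.rpow_nonneg hY0.le γ) d
          have : 2 * Real.sqrt 2 ≤ (2 * Real.sqrt 2) ^ d := le_self_pow₀ h22 (by omega)
          gcongr
      _ = (K₂ * τ * Y ^ γ / (d : ℝ) ^ 2) ^ d := by
          rw [hK₂]
          simp only [div_pow, mul_pow]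
          rw [pow_mul]
          ring
  -- Step 5: `Y^γ ≤ 36^γ Q^γ (d^γ + L'^γ)`
  have hYγ : Y ^ γ ≤ 36 ^ γ * Q ^ γ * ((d : ℝ) ^ γ + L' ^ γ) := by
    have hL'0 : 0 ≤ L' := zero_le_one.trans hL'
    calc Y ^ γ ≤ (18 * Q * (d + L')) ^ γ := Real.rpow_le_rpow hY0.le hYle hγ0.le
      _ = 18 ^ γ * Q ^ γ * ((d : ℝ) + L') ^ γ := by
          rw [Real.mul_rpow (by positivity) (by positivity), Real.mul_rpow (by norm_num) hQ0.le]
      _ ≤ 18 ^ γ * Q ^ γ * (2 ^ γ * ((d : ℝ) ^ γ + L' ^ γ)) :=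
          mul_le_mul_of_nonneg_left (add_rpow_le_two_rpow_mul hd0.le hL'0 hγ0.le) (by positivity)
      _ = 36 ^ γ * Q ^ γ * ((d : ℝ) ^ γ + L' ^ γ) := by
          rw [show (36 : ℝ) = 18 * 2 by norm_num, Real.mul_rpow (by norm_num) (by norm_num)]
          ring
  -- Step 6: the two terms
  have hdγ : (d : ℝ) ^ γ / (d : ℝ) ^ 2 = 1 / (d : ℝ) ^ (2 - γ) := by
    rw [Real.rpow_sub hd0, Real.rpow_two]
    field_simp
  have hterm1 : τ * Q ^ γ * (d : ℝ) ^ γ / (d : ℝ) ^ 2 ≤ 1 / A ^ (2 - γ) := by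
    -- `d^{2-γ} ≥ (A X L')^{2-γ} = A^{2-γ} B L'^{2-γ} ≥ A^{2-γ} B`
    have hAXL0 : 0 < A * X * L' := by positivity
    have hL'pow : 1 ≤ L' ^ (2 - γ) := Real.one_le_rpow hL' h2γ.le
    have hden : A ^ (2 - γ) * B ≤ (d : ℝ) ^ (2 - γ) := by
      calc A ^ (2 - γ) * B = A ^ (2 - γ) * X ^ (2 - γ) * 1 := by rw [hXpow, mul_one]
        _ ≤ A ^ (2 - γ) * X ^ (2 - γ) * L' ^ (2 - γ) := by
            refine mul_le_mul_of_nonneg_left hL'pow ?_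
            exact mul_nonneg (Real.rpow_nonneg hA0.le _) (Real.rpow_nonneg hX0.le _)
        _ = (A * X * L') ^ (2 - γ) := by
            rw [Real.mul_rpow (by positivity) (zero_le_one.trans hL'),
              Real.mul_rpow hA0.le hX0.le]
        _ ≤ (d : ℝ) ^ (2 - γ) := Real.rpow_le_rpow hAXL0.le hAXL h2γ.le
    have hApos : 0 < A ^ (2 - γ) := Real.rpow_pos_of_pos hA0 _
    have hdpos : 0 < (d : ℝ) ^ (2 - γ) := Real.rpow_pos_of_pos hd0 _
    calc τ * Q ^ γ * (d : ℝ) ^ γ / (d : ℝ) ^ 2 = τ * Q ^ γ * ((d : ℝ) ^ γ / (d : ℝ) ^ 2) := by ring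
      _ = τ * Q ^ γ / (d : ℝ) ^ (2 - γ) := by rw [hdγ]; ring
      _ ≤ τ * Q ^ γ / (A ^ (2 - γ) * B) := div_le_div_of_nonneg_left (by positivity) (by positivity) hden
      _ = (τ * Q ^ γ / B) * (1 / A ^ (2 - γ)) := by field_simp
      _ ≤ 1 * (1 / A ^ (2 - γ)) := by
          refine mul_le_mul_of_nonneg_right ?_ (by positivity)
          rw [div_le_one hB0, hB]; linarith
      _ = 1 / A ^ (2 - γ) := one_mul _
  have hterm2 : τ * Q ^ γ * L' ^ γ / (d : ℝ) ^ 2 ≤ 1 / A ^ 2 := by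
    have hL'0 : 0 < L' := one_pos.trans_le hL'
    -- `X² ≥ X^{2-γ} = B ≥ τ Q^γ`
    have hX2 : τ * Q ^ γ ≤ X ^ 2 := by
      calc τ * Q ^ γ ≤ B := by rw [hB]; linarith
        _ = X ^ (2 - γ) := hXpow.symm
        _ ≤ X ^ (2 : ℝ) := Real.rpow_le_rpow_of_exponent_le hX1 (by linarith)
        _ = X ^ 2 := Real.rpow_two X
    -- `L'^γ ≤ L'^2`
    have hL'γ : L' ^ γ ≤ L' ^ 2 := by
      calc L' ^ γ ≤ L' ^ (2 : ℝ) := Real.rpow_le_rpow_of_exponent_le hL' hγ2.le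
        _ = L' ^ 2 := Real.rpow_two L'
    have hden : (A * X * L') ^ 2 ≤ (d : ℝ) ^ 2 := pow_le_pow_left₀ (by positivity) hAXL 2
    calc τ * Q ^ γ * L' ^ γ / (d : ℝ) ^ 2 ≤ X ^ 2 * L' ^ 2 / (d : ℝ) ^ 2 := by
          gcongr
      _ ≤ X ^ 2 * L' ^ 2 / (A * X * L') ^ 2 :=
          div_le_div_of_nonneg_left (by positivity) (by positivity) hden
      _ = 1 / A ^ 2 := by field_simp
  -- Step 7: the bracket is at most `1/64`
  have hbracket : K₂ * τ * Y ^ γ / (d : ℝ) ^ 2 ≤ 1 / 64 := by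
    have h1 : K₂ * τ * Y ^ γ / (d : ℝ) ^ 2 ≤
        C₀ * (τ * Q ^ γ * (d : ℝ) ^ γ / (d : ℝ) ^ 2) + C₀ * (τ * Q ^ γ * L' ^ γ / (d : ℝ) ^ 2) := by
      calc K₂ * τ * Y ^ γ / (d : ℝ) ^ 2 ≤ K₂ * τ * (36 ^ γ * Q ^ γ * ((d : ℝ) ^ γ + L' ^ γ)) / (d : ℝ) ^ 2 := by
            gcongr
        _ = C₀ * (τ * Q ^ γ * (d : ℝ) ^ γ / (d : ℝ) ^ 2) + C₀ * (τ * Q ^ γ * L' ^ γ / (d : ℝ) ^ 2) := by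
            rw [hC₀]; ring
    have h2 : C₀ * (τ * Q ^ γ * (d : ℝ) ^ γ / (d : ℝ) ^ 2) ≤ C₀ * (1 / A ^ (2 - γ)) :=
      mul_le_mul_of_nonneg_left hterm1 hC₀0
    have h3 : C₀ * (τ * Q ^ γ * L' ^ γ / (d : ℝ) ^ 2) ≤ C₀ * (1 / A ^ 2) :=
      mul_le_mul_of_nonneg_left hterm2 hC₀0
    have h4 : C₀ * (1 / A ^ (2 - γ)) ≤ 1 / 128 := by
      have hApos : 0 < A ^ (2 - γ) := Real.rpow_pos_of_pos hA0 _
      rw [mul_one_div, div_le_iff₀ hApos]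
      linarith
    have h5 : C₀ * (1 / A ^ 2) ≤ 1 / 128 := by
      have hApos : 0 < A ^ 2 := by positivity
      rw [mul_one_div, div_le_iff₀ hApos]
      linarith
    linarith
  have hbr0 : 0 ≤ K₂ * τ * Y ^ γ / (d : ℝ) ^ 2 := by
    have : 0 ≤ Y ^ γ := Real.rpow_nonneg hY0.le γ
    positivity
  calc 2 * Real.sqrt 2 * t * Real.sqrt Y * (K₁ * Y ^ η) ^ d * t ^ (2 * d) / (2 * d).factorial
      ≤ (K₂ * τ * Y ^ γ / (d : ℝ) ^ 2) ^ d := hstep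
    _ ≤ (1 / 64) ^ d := pow_le_pow_left₀ hbr0 hbracket d

end Arith

/-! ### §5b The constants attached to the polynomials `U`, `V` -/

section Constants

variable {P : OscillatorChain} {s₁ s₂ : ℕ}

/-- Lipschitz bound for a `C¹` function near a point from a derivative bound of polynomial type:
if `|f'(ξ)| ≤ C (1+|ξ|)^d` then for `|q - q'| ≤ 1`, `|f q - f q'| ≤ C 2^d (1+|q|)^d |q - q'|`.
[folklore] -/
theorem abs_sub_le_of_deriv_poly_bound {f : ℝ → ℝ} (hf : ContDiff ℝ 2 f) {C : ℝ} {d : ℕ}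
    (hC : 0 ≤ C) (hb : ∀ ξ, |deriv f ξ| ≤ C * (1 + |ξ|) ^ d) {q q' : ℝ} (hqq' : |q - q'| ≤ 1) :
    |f q - f q'| ≤ C * 2 ^ d * (1 + |q|) ^ d * |q - q'| := by
  have hfd : Differentiable ℝ f := hf.differentiable (by simp)
  have hbound : ∀ ξ ∈ Set.uIcc q q', ‖deriv f ξ‖ ≤ C * 2 ^ d * (1 + |q|) ^ d := by
    intro ξ hξ
    rw [Real.norm_eq_abs]
    have hξq : |ξ - q| ≤ 1 := by
      have h1 : |ξ - q| ≤ |q' - q| := Set.abs_sub_left_of_mem_uIcc hξ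
      rw [abs_sub_comm q' q] at h1
      exact h1.trans hqq'
    have hξ1 : 1 + |ξ| ≤ 2 * (1 + |q|) := by
      have : |ξ| ≤ |q| + 1 := by
        calc |ξ| = |(ξ - q) + q| := by ring_nf
          _ ≤ |ξ - q| + |q| := abs_add_le _ _
          _ ≤ 1 + |q| := by linarith
          _ = |q| + 1 := by ring
      linarith [abs_nonneg q]
    calc |deriv f ξ| ≤ C * (1 + |ξ|) ^ d := hb ξ
      _ ≤ C * (2 * (1 + |q|)) ^ d := by gcongr
      _ = C * 2 ^ d * (1 + |q|) ^ d := by rw [mul_pow]; ring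
  have key := (convex_uIcc q q').norm_image_sub_le_of_norm_deriv_le (fun ξ _ => hfd ξ) hbound
    (Set.left_mem_uIcc) (Set.right_mem_uIcc)
  rw [Real.norm_eq_abs, Real.norm_eq_abs, abs_sub_comm] at key
  rwa [abs_sub_comm q q']

/-- **The constants of the polynomials.** From the hypotheses of Thm 2.1 (`U`, `V` even non-negative
polynomials of degrees `2s₁, 2s₂ ≥ 2`) we extract `K₁ ≥ 0`, `K₂ ≥ 1` such that, with
`η = (σ-1)/σ`, `σ = max{s₁,s₂}`: (i) the force is Lipschitz at a site with constant `K₁ Y^η`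
whenever the pinning energies at the site are `≤ Y` and the bond energies at the site are `≤ 3Y`
(BM (3.4)–(3.5): `T ≤ C W^η`); (ii) positions / elongations with energy `≤ Y` / `≤ 3Y` are
bounded by `K₂ Y`; (iii) `U`, `V` are `K₂ Y`-Lipschitz within distance `1` of such points.
[cite: ButtaMarchioro2016, §3 eqs. (3.4)–(3.5)] -/
theorem exists_constants (hs₁ : 1 ≤ s₁) (hs₂ : 1 ≤ s₂)
    (hU1 : IsEvenPolyOfDegree P.U s₁) (hV1 : IsEvenPolyOfDegree P.V s₂) :
    ∃ K₁ K₂ : ℝ, 0 ≤ K₁ ∧ 1 ≤ K₂ ∧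
      (∀ Y : ℝ, 1 ≤ Y → ∀ (σ₁ σ₂ : ChainConfig) (i : ℤ) (δ : ℝ),
        P.U (σ₁ i).1 ≤ Y → P.U (σ₂ i).1 ≤ Y →
        P.V ((σ₁ (i + 1)).1 - (σ₁ i).1) ≤ 3 * Y → P.V ((σ₁ i).1 - (σ₁ (i - 1)).1) ≤ 3 * Y →
        P.V ((σ₂ (i + 1)).1 - (σ₂ i).1) ≤ 3 * Y → P.V ((σ₂ i).1 - (σ₂ (i - 1)).1) ≤ 3 * Y →
        (∀ j, i - 1 ≤ j → j ≤ i + 1 → |(σ₁ j).1 - (σ₂ j).1| ≤ δ) →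
        |P.force σ₁ i - P.force σ₂ i| ≤
          K₁ * Y ^ ((((max s₁ s₂ : ℕ) : ℝ) - 1) / ((max s₁ s₂ : ℕ) : ℝ)) * δ) ∧
      (∀ Y q : ℝ, 1 ≤ Y → P.U q ≤ Y → 1 + |q| ≤ K₂ * Y) ∧
      (∀ Y r : ℝ, 1 ≤ Y → P.V r ≤ 3 * Y → 1 + |r| ≤ K₂ * Y) ∧
      (∀ Y q q' : ℝ, 1 ≤ Y → P.U q ≤ Y → |q - q'| ≤ 1 → |P.U q - P.U q'| ≤ K₂ * Y * |q - q'|) ∧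
      (∀ Y r r' : ℝ, 1 ≤ Y → P.V r ≤ 3 * Y → |r - r'| ≤ 1 →
        |P.V r - P.V r'| ≤ K₂ * Y * |r - r'|) := by
  obtain ⟨CU, hCU0, hU', hU''⟩ := hU1.exists_deriv_bound
  obtain ⟨CV, hCV0, hV', hV''⟩ := hV1.exists_deriv_bound
  obtain ⟨KU, hKU1, hKU⟩ := hU1.exists_one_add_abs_pow_le hs₁
  obtain ⟨KV, hKV1, hKV⟩ := hV1.exists_one_add_abs_pow_le hs₂
  have hU : ContDiff ℝ 2 P.U := hU1.contDiff_two
  have hV : ContDiff ℝ 2 P.V := hV1.contDiff_two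
  have hU0 : ∀ r, 0 ≤ P.U r := hU1.choose_spec.2.2
  have hV0 : ∀ r, 0 ≤ P.V r := hV1.choose_spec.2.2
  have hKU0 : 0 ≤ KU := zero_le_one.trans hKU1
  have hKV0 : 0 ≤ KV := zero_le_one.trans hKV1
  set η : ℝ := (((max s₁ s₂ : ℕ) : ℝ) - 1) / ((max s₁ s₂ : ℕ) : ℝ) with hη
  have hS1 : 1 ≤ max s₁ s₂ := le_max_of_le_left hs₁
  have hS1' : (1 : ℝ) ≤ ((max s₁ s₂ : ℕ) : ℝ) := by exact_mod_cast hS1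
  have hS0 : (0 : ℝ) < ((max s₁ s₂ : ℕ) : ℝ) := by linarith
  have hη1 : η ≤ 1 := by
    rw [hη, div_le_one hS0]; linarith
  have hη0 : 0 ≤ η := by
    rw [hη]; exact div_nonneg (by linarith) hS0.le
  -- exponents of `U''`, `V''` versus `η`
  have hm₁ : (((s₁ - 1 : ℕ) : ℝ)) / s₁ ≤ η := by
    have hs₁0 : (0 : ℝ) < s₁ := by exact_mod_cast hs₁
    have hle : (s₁ : ℝ) ≤ ((max s₁ s₂ : ℕ) : ℝ) := by exact_mod_cast le_max_left s₁ s₂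
    rw [Nat.cast_sub hs₁, Nat.cast_one, hη, div_le_div_iff₀ hs₁0 hS0]
    nlinarith
  have hm₂ : (((s₂ - 1 : ℕ) : ℝ)) / s₂ ≤ η := by
    have hs₂0 : (0 : ℝ) < s₂ := by exact_mod_cast hs₂
    have hle : (s₂ : ℝ) ≤ ((max s₁ s₂ : ℕ) : ℝ) := by exact_mod_cast le_max_right s₁ s₂
    rw [Nat.cast_sub hs₂, Nat.cast_one, hη, div_le_div_iff₀ hs₂0 hS0]
    nlinarith
  have hgU : ∀ a, |deriv (deriv P.U) a| ≤ CU * (1 + |a|) ^ (2 * (s₁ - 1)) := fun a => by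
    rw [show 2 * (s₁ - 1) = 2 * s₁ - 2 by omega]; exact hU'' a
  have hgV : ∀ r, |deriv (deriv P.V) r| ≤ CV * (1 + |r|) ^ (2 * (s₂ - 1)) := fun r => by
    rw [show 2 * (s₂ - 1) = 2 * s₂ - 2 by omega]; exact hV'' r
  -- energy bounds give bounds on `(1+|q|)^{2s₁}` and `(1+|r|)^{2s₂}`
  have hqZ : ∀ Y q : ℝ, 1 ≤ Y → P.U q ≤ Y → (1 + |q|) ^ (2 * s₁) ≤ 2 * KU * Y := by
    intro Y q hY hq
    calc (1 + |q|) ^ (2 * s₁) ≤ KU * (P.U q + 1) := hKU q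
      _ ≤ KU * (Y + Y) := mul_le_mul_of_nonneg_left (by linarith) hKU0
      _ = 2 * KU * Y := by ring
  have hrZ : ∀ Y r : ℝ, 1 ≤ Y → P.V r ≤ 3 * Y → (1 + |r|) ^ (2 * s₂) ≤ 4 * KV * Y := by
    intro Y r hY hr
    calc (1 + |r|) ^ (2 * s₂) ≤ KV * (P.V r + 1) := hKV r
      _ ≤ KV * (3 * Y + Y) := mul_le_mul_of_nonneg_left (by linarith) hKV0
      _ = 4 * KV * Y := by ring
  have hpow1 : ∀ (x : ℝ) (n : ℕ), 0 ≤ x → 1 ≤ n → 1 + x ≤ (1 + x) ^ n := fun x n hx hn =>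
    le_self_pow₀ (by linarith) (by omega)
  set K₁ : ℝ := 2 * CU * KU + 16 * CV * KV with hK₁
  set K₂ : ℝ := max (max (2 * KU) (4 * KV)) (max (CU * 2 ^ (2 * s₁ - 1) * (2 * KU))
    (CV * 2 ^ (2 * s₂ - 1) * (4 * KV))) with hK₂
  have hK₂1 : 1 ≤ K₂ := le_max_of_le_left (le_max_of_le_left (by linarith))
  refine ⟨K₁, K₂, by positivity, hK₂1, ?_, ?_, ?_, ?_, ?_⟩
  · -- (i) the force Lipschitz bound `Θ ≤ K₁ Y^η`
    intro Y hY σ₁ σ₂ i δ hu₁ hu₂ hv₁ hv₁' hv₂ hv₂' hδ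
    have hY0 : 0 ≤ Y := zero_le_one.trans hY
    set ρU : ℝ := max |(σ₁ i).1| |(σ₂ i).1| with hρU
    set ρV : ℝ := max (max |(σ₁ (i + 1)).1 - (σ₁ i).1| |(σ₁ i).1 - (σ₁ (i - 1)).1|)
      (max |(σ₂ (i + 1)).1 - (σ₂ i).1| |(σ₂ i).1 - (σ₂ (i - 1)).1|) with hρV
    have hρU0 : 0 ≤ ρU := le_max_of_le_left (abs_nonneg _)
    have hρV0 : 0 ≤ ρV := le_max_of_le_left (le_max_of_le_left (abs_nonneg _))
    have hZU : (1 + ρU) ^ (2 * s₁) ≤ 2 * KU * Y := by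
      rcases max_choice |(σ₁ i).1| |(σ₂ i).1| with h | h <;> rw [hρU, h]
      · exact hqZ Y _ hY hu₁
      · exact hqZ Y _ hY hu₂
    have hZV : (1 + ρV) ^ (2 * s₂) ≤ 4 * KV * Y := by
      rcases max_choice (max |(σ₁ (i + 1)).1 - (σ₁ i).1| |(σ₁ i).1 - (σ₁ (i - 1)).1|)
        (max |(σ₂ (i + 1)).1 - (σ₂ i).1| |(σ₂ i).1 - (σ₂ (i - 1)).1|) with h | h <;> rw [hρV, h]
      · rcases max_choice |(σ₁ (i + 1)).1 - (σ₁ i).1| |(σ₁ i).1 - (σ₁ (i - 1)).1| with h' | h' <;>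
          rw [h']
        · exact hrZ Y _ hY hv₁
        · exact hrZ Y _ hY hv₁'
      · rcases max_choice |(σ₂ (i + 1)).1 - (σ₂ i).1| |(σ₂ i).1 - (σ₂ (i - 1)).1| with h' | h' <;>
          rw [h']
        · exact hrZ Y _ hY hv₂
        · exact hrZ Y _ hY hv₂'
    have h2KU : 1 ≤ 2 * KU * Y := by nlinarith
    have h4KV : 1 ≤ 4 * KV * Y := by nlinarith
    have hTU : (1 + ρU) ^ (2 * (s₁ - 1)) ≤ 2 * KU * Y ^ η := by
      calc (1 + ρU) ^ (2 * (s₁ - 1)) ≤ (2 * KU * Y) ^ η := pow_le_rpow_of_pow_le hs₁ hρU0 h2KU hZU hm₁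
        _ = (2 * KU) ^ η * Y ^ η := Real.mul_rpow (by positivity) hY0
        _ ≤ (2 * KU) * Y ^ η :=
            mul_le_mul_of_nonneg_right (rpow_le_self_of_one_le (by linarith) hη1)
              (Real.rpow_nonneg hY0 η)
    have hTV : (1 + ρV) ^ (2 * (s₂ - 1)) ≤ 4 * KV * Y ^ η := by
      calc (1 + ρV) ^ (2 * (s₂ - 1)) ≤ (4 * KV * Y) ^ η := pow_le_rpow_of_pow_le hs₂ hρV0 h4KV hZV hm₂
        _ = (4 * KV) ^ η * Y ^ η := Real.mul_rpow (by positivity) hY0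
        _ ≤ (4 * KV) * Y ^ η :=
            mul_le_mul_of_nonneg_right (rpow_le_self_of_one_le (by linarith) hη1)
              (Real.rpow_nonneg hY0 η)
    have hδ0 : 0 ≤ δ := (abs_nonneg _).trans (hδ i (by linarith) (by linarith))
    have key := force_sub_force_le hU hV hCU0 hCV0 hgU hgV hρU0 hρV0 (σ₁ := σ₁) (σ₂ := σ₂) (i := i)
      (le_max_left _ _) (le_max_right _ _)
      (le_max_of_le_left (le_max_left _ _)) (le_max_of_le_left (le_max_right _ _))
      (le_max_of_le_right (le_max_left _ _)) (le_max_of_le_right (le_max_right _ _)) hδ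
    calc |P.force σ₁ i - P.force σ₂ i|
        ≤ (CU * (1 + ρU) ^ (2 * (s₁ - 1)) + 4 * CV * (1 + ρV) ^ (2 * (s₂ - 1))) * δ := key
      _ ≤ (CU * (2 * KU * Y ^ η) + 4 * CV * (4 * KV * Y ^ η)) * δ := by
          apply mul_le_mul_of_nonneg_right _ hδ0
          gcongr
      _ = K₁ * Y ^ η * δ := by rw [hK₁]; ring
  · -- (ii) positions
    intro Y q hY hq
    calc 1 + |q| ≤ (1 + |q|) ^ (2 * s₁) := hpow1 _ _ (abs_nonneg q) (by omega)
      _ ≤ 2 * KU * Y := hqZ Y q hY hq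
      _ ≤ K₂ * Y := mul_le_mul_of_nonneg_right (le_max_of_le_left (le_max_left _ _))
          (zero_le_one.trans hY)
  · -- (ii') elongations
    intro Y r hY hr
    calc 1 + |r| ≤ (1 + |r|) ^ (2 * s₂) := hpow1 _ _ (abs_nonneg r) (by omega)
      _ ≤ 4 * KV * Y := hrZ Y r hY hr
      _ ≤ K₂ * Y := mul_le_mul_of_nonneg_right (le_max_of_le_left (le_max_right _ _))
          (zero_le_one.trans hY)
  · -- (iii) `U` is Lipschitz near energy level `Y`
    intro Y q q' hY hq hqq'
    have h1 := abs_sub_le_of_deriv_poly_bound hU hCU0 hU' hqq'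
    have h2 : (1 + |q|) ^ (2 * s₁ - 1) ≤ 2 * KU * Y :=
      le_trans (pow_le_pow_right₀ (by linarith [abs_nonneg q]) (by omega)) (hqZ Y q hY hq)
    calc |P.U q - P.U q'| ≤ CU * 2 ^ (2 * s₁ - 1) * (1 + |q|) ^ (2 * s₁ - 1) * |q - q'| := h1
      _ ≤ CU * 2 ^ (2 * s₁ - 1) * (2 * KU * Y) * |q - q'| := by gcongr
      _ = (CU * 2 ^ (2 * s₁ - 1) * (2 * KU)) * Y * |q - q'| := by ring
      _ ≤ K₂ * Y * |q - q'| := by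
          gcongr
          exact le_max_of_le_right (le_max_left _ _)
  · -- (iii') `V` is Lipschitz near energy level `3Y`
    intro Y r r' hY hr hrr'
    have h1 := abs_sub_le_of_deriv_poly_bound hV hCV0 hV' hrr'
    have h2 : (1 + |r|) ^ (2 * s₂ - 1) ≤ 4 * KV * Y :=
      le_trans (pow_le_pow_right₀ (by linarith [abs_nonneg r]) (by omega)) (hrZ Y r hY hr)
    calc |P.V r - P.V r'| ≤ CV * 2 ^ (2 * s₂ - 1) * (1 + |r|) ^ (2 * s₂ - 1) * |r - r'| := h1
      _ ≤ CV * 2 ^ (2 * s₂ - 1) * (4 * KV * Y) * |r - r'| := by gcongr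
      _ = (CV * 2 ^ (2 * s₂ - 1) * (4 * KV)) * Y * |r - r'| := by ring
      _ ≤ K₂ * Y * |r - r'| := by
          gcongr
          exact le_max_of_le_right (le_max_right _ _)

end Constants

/-! ### §6 Consecutive partial dynamics (BM §3, (3.3)–(3.13)): `u^{μ,n}_k(t) ≤ 4^{-(n+1-k)}` -/

section Consecutive

variable {P : OscillatorChain} {s₁ s₂ : ℕ}

/-- `2j + c ≤ 2^j c` for `c ≥ 2`. [folklore] -/
theorem two_mul_add_le_two_pow_mul (j : ℕ) {c : ℝ} (hc : 2 ≤ c) : 2 * (j : ℝ) + c ≤ 2 ^ j * c := by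
  induction j with
  | zero => simp
  | succ j ih =>
    have h2 : (1 : ℝ) ≤ 2 ^ j := one_le_pow₀ (by norm_num)
    push_cast
    calc 2 * ((j : ℝ) + 1) + c = (2 * j + c) + 2 := by ring
      _ ≤ 2 ^ j * c + 2 ^ j * c := by nlinarith
      _ = 2 ^ (j + 1) * c := by ring

/-- **Consecutive partial dynamics are exponentially close** (BM §3, (3.10)–(3.13), `d = 1`).
For `U, V` even non-negative polynomials of degrees `2s₁, 2s₂ ≥ 2`, `γ ∈ (η, 2)`, `β' > 0`, there
are `A ≥ 1`, `K ≥ 0` such that for every `x ∈ 𝒳₀`, every centre `μ`, horizon `t ≥ 0` and radii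
`k ≤ n` with `n ≥ 2k + 2 + A (1 + t²(1+t^{β'}) Q(x)^γ)^{1/(2-γ)} log(e+|μ|)` (BM's `n ≥ n_k^*`),
the severed flows in `Λ_{μ,n+1}` and `Λ_{μ,n}` satisfy, at every `i ∈ Λ_{μ,k}` and `|s| ≤ t`,
`|q^{n+1}_i(s) - q^n_i(s)| ≤ 64^{-(n+1-k)}` and
`|p^{n+1}_i(s) - p^n_i(s)| ≤ t K Q(x)^η (2k + 2 log(e+|μ|) + 7) 32^{-(n-k)}`.
[cite: ButtaMarchioro2016, §3 eqs. (3.10)–(3.13)] -/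
theorem consecutive_estimate (hs₁ : 1 ≤ s₁) (hs₂ : 1 ≤ s₂)
    (hU1 : IsEvenPolyOfDegree P.U s₁) (hV1 : IsEvenPolyOfDegree P.V s₂) (hB1 : P.CondB1)
    {γ β' : ℝ} (hγ : (((max s₁ s₂ : ℕ) : ℝ) - 1) / ((max s₁ s₂ : ℕ) : ℝ) < γ) (hγ2 : γ < 2)
    (hβ' : 0 < β') :
    ∃ A K : ℝ, 1 ≤ A ∧ 0 ≤ K ∧ ∀ x ∈ P.bmGood, ∀ (μ : ℤ) (t : ℝ), 0 ≤ t → ∀ (k n : ℕ),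
      2 * (k : ℝ) + 2 + A * (1 + t ^ 2 * (1 + t ^ β') * P.bmGrowth x ^ γ) ^ (1 / (2 - γ)) *
        Real.log (Real.exp 1 + |(μ : ℝ)|) ≤ n →
      ∀ i ∈ Finset.Icc (μ - k) (μ + k), ∀ s : ℝ, |s| ≤ t →
        |(severedFlow hB1 (Finset.Icc (μ - (n + 1 : ℕ)) (μ + (n + 1 : ℕ))) s x i).1 -
            (severedFlow hB1 (Finset.Icc (μ - n) (μ + n)) s x i).1| ≤ (1 / 64) ^ (n + 1 - k) ∧
        |(severedFlow hB1 (Finset.Icc (μ - (n + 1 : ℕ)) (μ + (n + 1 : ℕ))) s x i).2 -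
            (severedFlow hB1 (Finset.Icc (μ - n) (μ + n)) s x i).2| ≤
          t * K * P.bmGrowth x ^ ((((max s₁ s₂ : ℕ) : ℝ) - 1) / ((max s₁ s₂ : ℕ) : ℝ)) *
            (2 * k + 2 * Real.log (Real.exp 1 + |(μ : ℝ)|) + 7) * (1 / 32) ^ (n - k) := by
  have hU : ContDiff ℝ 2 P.U := hU1.contDiff_two
  have hV : ContDiff ℝ 2 P.V := hV1.contDiff_two
  have hU0 : ∀ r, 0 ≤ P.U r := hU1.choose_spec.2.2
  have hV0 : ∀ r, 0 ≤ P.V r := hV1.choose_spec.2.2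
  have hVe : ∀ r, P.V (-r) = P.V r := fun r => congrFun hV1.comp_neg r
  obtain ⟨K₁, K₂, hK₁0, hK₂1, hLipF, -, -, -, -⟩ := exists_constants hs₁ hs₂ hU1 hV1
  set η : ℝ := (((max s₁ s₂ : ℕ) : ℝ) - 1) / ((max s₁ s₂ : ℕ) : ℝ) with hη
  have hS1 : (1 : ℝ) ≤ ((max s₁ s₂ : ℕ) : ℝ) := by exact_mod_cast le_max_of_le_left hs₁
  have hS0 : (0 : ℝ) < ((max s₁ s₂ : ℕ) : ℝ) := by linarith
  have hη1 : η ≤ 1 := by rw [hη, div_le_one hS0]; linarith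
  have hη0 : 0 ≤ η := by rw [hη]; exact div_nonneg (by linarith) hS0.le
  obtain ⟨A, hA1, hA⟩ := bm_arith hK₁0 hη0 hγ hγ2 hβ'
  refine ⟨A, K₁, hA1, hK₁0, ?_⟩
  intro x hx μ t ht k n hn i hi s hs
  -- notation and basic facts
  set Q := P.bmGrowth x with hQ
  set L := Real.log (Real.exp 1 + |(μ : ℝ)|) with hL
  have hQ1 : 1 ≤ Q := one_le_bmGrowth hU0 hV0 hx
  have hL1 : 1 ≤ L := one_le_log_exp_add_abs μ
  have hQ0 : 0 ≤ Q := zero_le_one.trans hQ1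
  have hQγ : 0 ≤ Q ^ γ := Real.rpow_nonneg hQ0 γ
  set X := (1 + t ^ 2 * (1 + t ^ β') * Q ^ γ) ^ (1 / (2 - γ)) with hX
  have htb : 0 ≤ t ^ β' := Real.rpow_nonneg ht β'
  have hX1 : 1 ≤ X := by
    have h1 : 0 ≤ t ^ 2 * (1 + t ^ β') * Q ^ γ := by positivity
    have h2 : 0 < 2 - γ := by linarith
    exact Real.one_le_rpow (by linarith) (by positivity)
  have hAXL0 : 0 ≤ A * X * L := by
    have : 0 ≤ A := zero_le_one.trans hA1
    have : 0 ≤ X := zero_le_one.trans hX1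
    positivity
  have hkn : 2 * (k : ℝ) + 2 ≤ n := by linarith
  have hkn' : 2 * k + 2 ≤ n := by exact_mod_cast hkn
  set Y := P.bmLocalEnergy μ (n + 2) x with hY
  have hY1 : 1 ≤ Y := one_le_bmLocalEnergy hU0 hV0 μ (n + 2) x
  have hY0 : 0 < Y := one_pos.trans_le hY1
  have hYle : Y ≤ Q * (2 * n + 2 * L + 7) := by
    have h := bmLocalEnergy_le hU0 hV0 hx μ (n + 2)
    rw [hY]; push_cast at h ⊢; linarith
  have hW1Y : P.bmLocalEnergy μ (n + 1) x ≤ Y := bmLocalEnergy_mono hU0 hV0 μ (by omega) x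
  -- the two severed flows
  set Λ₁ := Finset.Icc (μ - (n + 1 : ℕ)) (μ + (n + 1 : ℕ)) with hΛ₁
  set Λ₂ := Finset.Icc (μ - n) (μ + n) with hΛ₂
  have h12 : Λ₂ ⊆ Λ₁ := cbox_subset (Nat.le_succ n)
  set γ₁ : ℝ → ChainConfig := fun s => severedFlow hB1 Λ₁ s x with hγ₁
  set γ₂ : ℝ → ChainConfig := fun s => severedFlow hB1 Λ₂ s x with hγ₂
  have hsol₁ : P.IsSeveredSolution Λ₁ γ₁ := isSeveredSolution_severedFlow hB1 Λ₁ x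
  have hsol₂ : P.IsSeveredSolution Λ₂ γ₂ := isSeveredSolution_severedFlow hB1 Λ₂ x
  -- energy bounds
  have hE₁ : ∀ s, (∀ j ∈ Λ₁, (γ₁ s j).2 ^ 2 / 2 ≤ Y ∧ P.U (γ₁ s j).1 ≤ Y) ∧
      ∀ j ∈ sevBonds Λ₁, P.V ((γ₁ s (j + 1)).1 - (γ₁ s j).1) ≤ Y := by
    intro s
    have h := severedFlow_energy_bounds hU hV hU0 hV0 hB1 hVe μ (n + 1) x s
    exact ⟨h.1, h.2.1⟩
  have hE₂ : ∀ s, (∀ j ∈ Λ₂, (γ₂ s j).2 ^ 2 / 2 ≤ Y ∧ P.U (γ₂ s j).1 ≤ Y) ∧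
      ∀ j ∈ sevBonds Λ₂, P.V ((γ₂ s (j + 1)).1 - (γ₂ s j).1) ≤ Y := by
    intro s
    have h := severedFlow_energy_bounds hU hV hU0 hV0 hB1 hVe μ n x s
    exact ⟨fun j hj => ⟨(h.1 j hj).1.trans hW1Y, (h.1 j hj).2.trans hW1Y⟩,
      fun j hj => (h.2.1 j hj).trans hW1Y⟩
  -- frozen sites of `γ₂`
  have hfro₂ : ∀ s, ∀ j ∉ Λ₂, γ₂ s j = x j := fun s j hj => severedFlow_apply_of_not_mem hB1 Λ₂ s x hj
  -- ENGINE hypotheses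
  set Θ : ℝ := K₁ * Y ^ η with hΘ
  have hΘ0 : 0 ≤ Θ := mul_nonneg hK₁0 (Real.rpow_nonneg hY0.le η)
  set D : ℝ := 2 * Real.sqrt 2 * t * Real.sqrt Y with hD
  have hode₁ : ∀ i ∈ Λ₂, ∀ s, HasDerivAt (fun s => (γ₁ s i).1) (γ₁ s i).2 s ∧
      HasDerivAt (fun s => (γ₁ s i).2) (P.force (γ₁ s) i) s := fun i hi s => hsol₁.1 i (h12 hi) s
  have hode₂ : ∀ i ∈ Λ₂, ∀ s, HasDerivAt (fun s => (γ₂ s i).1) (γ₂ s i).2 s ∧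
      HasDerivAt (fun s => (γ₂ s i).2) (P.force (γ₂ s) i) s := fun i hi s => hsol₂.1 i hi s
  have h0 : ∀ i ∈ Λ₂, γ₁ 0 i = γ₂ 0 i := fun i _ => by simp [hγ₁, hγ₂]
  have hLip : ∀ s, |s| ≤ t → ∀ i ∈ Λ₂, ∀ δ : ℝ,
      (∀ j, i - 1 ≤ j → j ≤ i + 1 → |(γ₁ s j).1 - (γ₂ s j).1| ≤ δ) →
        |P.force (γ₁ s) i - P.force (γ₂ s) i| ≤ Θ * δ := by
    intro s _ i hi δ hδ
    have hiΛ₁ : i ∈ Λ₁ := h12 hi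
    have hi2 : i ∈ Λ₂ := hi
    rw [hΛ₂, Finset.mem_Icc] at hi2
    -- bonds at `i` meet both boxes
    have hb1 : i ∈ sevBonds Λ₁ := Finset.mem_union_left _ hiΛ₁
    have hb1' : i - 1 ∈ sevBonds Λ₁ :=
      Finset.mem_union_right _ (Finset.mem_image.2 ⟨i, hiΛ₁, rfl⟩)
    have hb2 : i ∈ sevBonds Λ₂ := Finset.mem_union_left _ hi
    have hb2' : i - 1 ∈ sevBonds Λ₂ := Finset.mem_union_right _ (Finset.mem_image.2 ⟨i, hi, rfl⟩)
    have e1 := (hE₁ s).2 i hb1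
    have e1' := (hE₁ s).2 (i - 1) hb1'
    have e2 := (hE₂ s).2 i hb2
    have e2' := (hE₂ s).2 (i - 1) hb2'
    simp only [sub_add_cancel] at e1' e2'
    exact hLipF Y hY1 (γ₁ s) (γ₂ s) i δ ((hE₁ s).1 i hiΛ₁).2 ((hE₂ s).1 i hi).2
      (by linarith) (by linarith) (by linarith) (by linarith) hδ
  have hdisp : ∀ s, |s| ≤ t → ∀ j ∈ Λ₁, |(γ₁ s j).1 - (γ₂ s j).1| ≤ D := by
    intro s hs j hj
    have hst : |s| * Real.sqrt (2 * Y) ≤ t * Real.sqrt (2 * Y) :=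
      mul_le_mul_of_nonneg_right hs (Real.sqrt_nonneg _)
    have d1 : |(γ₁ s j).1 - (x j).1| ≤ t * Real.sqrt (2 * Y) :=
      (severedFlow_displacement_le hU hV hU0 hV0 hB1 hVe μ (n + 1) x hj s).trans hst
    have d2 : |(γ₂ s j).1 - (x j).1| ≤ t * Real.sqrt (2 * Y) := by
      by_cases hj2 : j ∈ Λ₂
      · refine (severedFlow_displacement_le hU hV hU0 hV0 hB1 hVe μ n x hj2 s).trans ?_
        calc |s| * Real.sqrt (2 * P.bmLocalEnergy μ (n + 1) x) ≤ |s| * Real.sqrt (2 * Y) := by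
              gcongr
          _ ≤ t * Real.sqrt (2 * Y) := hst
      · rw [show γ₂ s j = x j from hfro₂ s j hj2, sub_self, abs_zero]; positivity
    have hsq : Real.sqrt (2 * Y) = Real.sqrt 2 * Real.sqrt Y := Real.sqrt_mul (by norm_num) Y
    calc |(γ₁ s j).1 - (γ₂ s j).1| = |((γ₁ s j).1 - (x j).1) - ((γ₂ s j).1 - (x j).1)| := by ring_nf
      _ ≤ |(γ₁ s j).1 - (x j).1| + |(γ₂ s j).1 - (x j).1| := abs_sub _ _
      _ ≤ t * Real.sqrt (2 * Y) + t * Real.sqrt (2 * Y) := add_le_add d1 d2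
      _ = D := by rw [hD, hsq]; ring
  have engine := df_iterate hode₁ hode₂ h0 hLip hdisp
  -- the arithmetic at levels `k` (depth `n+1-k`) and `k+1` (depth `n-k`)
  have hk1 : k ≤ n := by omega
  have harith : ∀ d : ℕ, A * X * L ≤ d → (n : ℝ) ≤ 2 * d - 2 →
      D * Θ ^ d * t ^ (2 * d) / (2 * d).factorial ≤ (1 / 64) ^ d := by
    intro d hd hnd
    have hYd : Y ≤ 18 * Q * (d + L) := by
      calc Y ≤ Q * (2 * n + 2 * L + 7) := hYle
        _ ≤ Q * (18 * (d + L)) := by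
            apply mul_le_mul_of_nonneg_left _ hQ0
            linarith
        _ = 18 * Q * (d + L) := by ring
    have h := hA Q L t Y d hQ1 hL1 ht hY1 hYd hd
    calc D * Θ ^ d * t ^ (2 * d) / (2 * d).factorial
        = 2 * Real.sqrt 2 * t * Real.sqrt Y * (K₁ * Y ^ η) ^ d * t ^ (2 * d) / (2 * d).factorial := by
          rw [hD, hΘ]
      _ ≤ (1 / 64) ^ d := h
  have hmono : ∀ (d : ℕ) (s : ℝ), |s| ≤ t →
      D * Θ ^ d * |s| ^ (2 * d) / (2 * d).factorial ≤ D * Θ ^ d * t ^ (2 * d) / (2 * d).factorial := by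
    intro d s hs
    have hD0 : 0 ≤ D := by rw [hD]; positivity
    have : |s| ^ (2 * d) ≤ t ^ (2 * d) := pow_le_pow_left₀ (abs_nonneg s) hs _
    have hf : (0 : ℝ) < (2 * d).factorial := by positivity
    apply div_le_div_of_nonneg_right _ hf.le
    exact mul_le_mul_of_nonneg_left this (by positivity)
  -- level `k`
  have hdk : A * X * L ≤ ((n + 1 - k : ℕ) : ℝ) := by
    rw [Nat.cast_sub (by omega)]; push_cast; linarith
  have hndk : (n : ℝ) ≤ 2 * ((n + 1 - k : ℕ) : ℝ) - 2 := by
    rw [Nat.cast_sub (by omega)]; push_cast; linarith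
  have hq := (engine (n + 1 - k) k (by omega) i hi s hs).1
  -- level `k + 1`
  have hdk' : A * X * L ≤ ((n - k : ℕ) : ℝ) := by
    rw [Nat.cast_sub hk1]; linarith
  have hndk' : (n : ℝ) ≤ 2 * ((n - k : ℕ) : ℝ) - 2 := by
    rw [Nat.cast_sub hk1]; linarith
  have hlev : ∀ r, |r| ≤ t → ∀ j, i - 1 ≤ j → j ≤ i + 1 →
      |(γ₁ r j).1 - (γ₂ r j).1| ≤ (1 / 64) ^ (n - k) := by
    intro r hr j hj1 hj2
    have hjk : j ∈ Finset.Icc (μ - (k + 1 : ℕ)) (μ + (k + 1 : ℕ)) := by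
      rw [Finset.mem_Icc] at hi ⊢; push_cast; omega
    have h := (engine (n - k) (k + 1) (by omega) j hjk r hr).1
    exact h.trans ((hmono _ r hr).trans (harith (n - k) hdk' hndk'))
  refine ⟨hq.trans ((hmono _ s hs).trans (harith (n + 1 - k) hdk hndk)), ?_⟩
  -- the momenta: `Δp_i` has derivative `ΔF_i`, bounded by `Θ 64^{-(n-k)}` on `[-t, t]`
  have hiΛ₂ : i ∈ Λ₂ := cbox_subset hk1 hi
  have hderiv : ∀ r, HasDerivAt (fun r => (γ₁ r i).2 - (γ₂ r i).2)
      (P.force (γ₁ r) i - P.force (γ₂ r) i) r := fun r => (hode₁ i hiΛ₂ r).2.sub (hode₂ i hiΛ₂ r).2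
  have hFb : ∀ r ∈ Icc (-t) t, ‖P.force (γ₁ r) i - P.force (γ₂ r) i‖ ≤ Θ * (1 / 64) ^ (n - k) := by
    intro r hr
    rw [Real.norm_eq_abs]
    have hr' : |r| ≤ t := abs_le.2 hr
    exact hLip r hr' i hiΛ₂ _ (hlev r hr')
  have hst : s ∈ Icc (-t) t := abs_le.1 hs
  have h0t : (0 : ℝ) ∈ Icc (-t) t := ⟨by linarith, ht⟩
  have hmv := (convex_Icc (-t) t).norm_image_sub_le_of_norm_hasDerivWithin_le
    (fun r _ => (hderiv r).hasDerivWithinAt) hFb h0t hst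
  have hp0 : (γ₁ 0 i).2 - (γ₂ 0 i).2 = 0 := by simp [hγ₁, hγ₂]
  rw [hp0, sub_zero, Real.norm_eq_abs, Real.norm_eq_abs, sub_zero] at hmv
  -- `Θ = K₁ Y^η ≤ K₁ Q^η (2n + 2L + 7) ≤ K₁ Q^η (2k + 2L + 7) 2^{n-k}`
  have hΘle : Θ ≤ K₁ * (Q ^ η * (2 * n + 2 * L + 7)) := by
    rw [hΘ]
    refine mul_le_mul_of_nonneg_left ?_ hK₁0
    have h1 : 1 ≤ 2 * (n : ℝ) + 2 * L + 7 := by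
      have : (0 : ℝ) ≤ n := Nat.cast_nonneg n
      linarith
    calc Y ^ η ≤ (Q * (2 * n + 2 * L + 7)) ^ η := Real.rpow_le_rpow hY0.le hYle hη0
      _ = Q ^ η * (2 * n + 2 * L + 7) ^ η := Real.mul_rpow hQ0 (by linarith)
      _ ≤ Q ^ η * (2 * n + 2 * L + 7) :=
          mul_le_mul_of_nonneg_left (rpow_le_self_of_one_le h1 hη1) (Real.rpow_nonneg hQ0 η)
  have hQη : 0 ≤ Q ^ η := Real.rpow_nonneg hQ0 η
  have hgeo : 2 * (n : ℝ) + 2 * L + 7 ≤ 2 ^ (n - k) * (2 * k + 2 * L + 7) := by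
    have h := two_mul_add_le_two_pow_mul (n - k) (c := 2 * k + 2 * L + 7) (by linarith)
    rw [Nat.cast_sub hk1] at h
    linarith
  have h14 : ((1 : ℝ) / 64) ^ (n - k) = (1 / 2) ^ (n - k) * (1 / 32) ^ (n - k) := by
    rw [← mul_pow]; norm_num
  have h22 : (2 : ℝ) ^ (n - k) * (1 / 2) ^ (n - k) = 1 := by
    rw [← mul_pow]; norm_num
  calc |(γ₁ s i).2 - (γ₂ s i).2| ≤ Θ * (1 / 64) ^ (n - k) * |s| := hmv
    _ ≤ K₁ * (Q ^ η * (2 * n + 2 * L + 7)) * (1 / 64) ^ (n - k) * t := by gcongr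
    _ ≤ K₁ * (Q ^ η * (2 ^ (n - k) * (2 * k + 2 * L + 7))) * (1 / 64) ^ (n - k) * t := by gcongr
    _ = t * K₁ * Q ^ η * (2 * k + 2 * L + 7) * (1 / 32) ^ (n - k) *
          (2 ^ (n - k) * (1 / 2) ^ (n - k)) := by
        rw [h14]; ring
    _ = t * K₁ * Q ^ η * (2 * k + 2 * L + 7) * (1 / 32) ^ (n - k) := by rw [h22, mul_one]

end Consecutive

/-! ### §6b The engine fed with energy-type bounds -/

section EngineEnergy

variable {P : OscillatorChain} {s₁ s₂ : ℕ}

/-- **The Dobrushin–Fritz iteration from energy-type bounds.** Two curves solving the equations of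
motion on `Λ_{μ,n}`, starting from `x` on `Λ_{μ,n+1}`, whose pinning energies on `Λ_{μ,n+1}` and bond
energies on the bonds inside `Λ_{μ,n+1}` are `≤ Y` for `|s| ≤ t`, and whose displacements there are
`≤ t (2Y)^{1/2}`, satisfy the iterated bounds of `df_iterate` with `D = 2√2 t √Y`, `Θ = K₁ Y^η`
(`K₁` the force-Lipschitz constant of `exists_constants`). [cite: ButtaMarchioro2016, §3 eqs. (3.3)–(3.9)] -/
theorem df_iterate_energy {K₁ η : ℝ}
    (hLipF : ∀ Y : ℝ, 1 ≤ Y → ∀ (σ₁ σ₂ : ChainConfig) (i : ℤ) (δ : ℝ),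
        P.U (σ₁ i).1 ≤ Y → P.U (σ₂ i).1 ≤ Y →
        P.V ((σ₁ (i + 1)).1 - (σ₁ i).1) ≤ 3 * Y → P.V ((σ₁ i).1 - (σ₁ (i - 1)).1) ≤ 3 * Y →
        P.V ((σ₂ (i + 1)).1 - (σ₂ i).1) ≤ 3 * Y → P.V ((σ₂ i).1 - (σ₂ (i - 1)).1) ≤ 3 * Y →
        (∀ j, i - 1 ≤ j → j ≤ i + 1 → |(σ₁ j).1 - (σ₂ j).1| ≤ δ) →
        |P.force σ₁ i - P.force σ₂ i| ≤ K₁ * Y ^ η * δ)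
    {γ₁ γ₂ : ℝ → ChainConfig} {x : ChainConfig} {μ : ℤ} {n : ℕ} {t Y : ℝ} (hY : 1 ≤ Y)
    (h₁ : ∀ i ∈ Finset.Icc (μ - n) (μ + n), ∀ s, HasDerivAt (fun s => (γ₁ s i).1) (γ₁ s i).2 s ∧
      HasDerivAt (fun s => (γ₁ s i).2) (P.force (γ₁ s) i) s)
    (h₂ : ∀ i ∈ Finset.Icc (μ - n) (μ + n), ∀ s, HasDerivAt (fun s => (γ₂ s i).1) (γ₂ s i).2 s ∧
      HasDerivAt (fun s => (γ₂ s i).2) (P.force (γ₂ s) i) s)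
    (h0₁ : ∀ j ∈ Finset.Icc (μ - (n + 1 : ℕ)) (μ + (n + 1 : ℕ)), γ₁ 0 j = x j)
    (h0₂ : ∀ j ∈ Finset.Icc (μ - (n + 1 : ℕ)) (μ + (n + 1 : ℕ)), γ₂ 0 j = x j)
    (hU₁ : ∀ s, |s| ≤ t → ∀ j ∈ Finset.Icc (μ - (n + 1 : ℕ)) (μ + (n + 1 : ℕ)), P.U (γ₁ s j).1 ≤ Y)
    (hU₂ : ∀ s, |s| ≤ t → ∀ j ∈ Finset.Icc (μ - (n + 1 : ℕ)) (μ + (n + 1 : ℕ)), P.U (γ₂ s j).1 ≤ Y)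
    (hV₁ : ∀ s, |s| ≤ t → ∀ j ∈ Finset.Icc (μ - n - 1) (μ + n),
      P.V ((γ₁ s (j + 1)).1 - (γ₁ s j).1) ≤ Y)
    (hV₂ : ∀ s, |s| ≤ t → ∀ j ∈ Finset.Icc (μ - n - 1) (μ + n),
      P.V ((γ₂ s (j + 1)).1 - (γ₂ s j).1) ≤ Y)
    (hq₁ : ∀ s, |s| ≤ t → ∀ j ∈ Finset.Icc (μ - (n + 1 : ℕ)) (μ + (n + 1 : ℕ)),
      |(γ₁ s j).1 - (x j).1| ≤ t * Real.sqrt (2 * Y))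
    (hq₂ : ∀ s, |s| ≤ t → ∀ j ∈ Finset.Icc (μ - (n + 1 : ℕ)) (μ + (n + 1 : ℕ)),
      |(γ₂ s j).1 - (x j).1| ≤ t * Real.sqrt (2 * Y)) :
    ∀ d k : ℕ, k + d = n + 1 → ∀ i ∈ Finset.Icc (μ - k) (μ + k), ∀ s, |s| ≤ t →
      |(γ₁ s i).1 - (γ₂ s i).1| ≤
        2 * Real.sqrt 2 * t * Real.sqrt Y * (K₁ * Y ^ η) ^ d * |s| ^ (2 * d) / (2 * d).factorial ∧
      (1 ≤ d → |(γ₁ s i).2 - (γ₂ s i).2| ≤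
        2 * Real.sqrt 2 * t * Real.sqrt Y * (K₁ * Y ^ η) ^ d * |s| ^ (2 * d - 1) /
          (2 * d - 1).factorial) := by
  have h0 : ∀ i ∈ Finset.Icc (μ - n) (μ + n), γ₁ 0 i = γ₂ 0 i := fun i hi => by
    rw [h0₁ i (cbox_subset (Nat.le_succ n) hi), h0₂ i (cbox_subset (Nat.le_succ n) hi)]
  have hLip : ∀ s, |s| ≤ t → ∀ i ∈ Finset.Icc (μ - n) (μ + n), ∀ δ : ℝ,
      (∀ j, i - 1 ≤ j → j ≤ i + 1 → |(γ₁ s j).1 - (γ₂ s j).1| ≤ δ) →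
        |P.force (γ₁ s) i - P.force (γ₂ s) i| ≤ K₁ * Y ^ η * δ := by
    intro s hs i hi δ hδ
    have hi' : i ∈ Finset.Icc (μ - (n + 1 : ℕ)) (μ + (n + 1 : ℕ)) := cbox_subset (Nat.le_succ n) hi
    rw [Finset.mem_Icc] at hi
    have hb : i ∈ Finset.Icc (μ - n - 1) (μ + n) := by rw [Finset.mem_Icc]; omega
    have hb' : i - 1 ∈ Finset.Icc (μ - n - 1) (μ + n) := by rw [Finset.mem_Icc]; omega
    have e1 := hV₁ s hs i hb
    have e1' := hV₁ s hs (i - 1) hb'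
    have e2 := hV₂ s hs i hb
    have e2' := hV₂ s hs (i - 1) hb'
    simp only [sub_add_cancel] at e1' e2'
    exact hLipF Y hY (γ₁ s) (γ₂ s) i δ (hU₁ s hs i hi') (hU₂ s hs i hi')
      (by linarith) (by linarith) (by linarith) (by linarith) hδ
  have hD : ∀ s, |s| ≤ t → ∀ j ∈ Finset.Icc (μ - (n + 1 : ℕ)) (μ + (n + 1 : ℕ)),
      |(γ₁ s j).1 - (γ₂ s j).1| ≤ 2 * Real.sqrt 2 * t * Real.sqrt Y := by
    intro s hs j hj
    have hsq : Real.sqrt (2 * Y) = Real.sqrt 2 * Real.sqrt Y := Real.sqrt_mul (by norm_num) Y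
    calc |(γ₁ s j).1 - (γ₂ s j).1| = |((γ₁ s j).1 - (x j).1) - ((γ₂ s j).1 - (x j).1)| := by ring_nf
      _ ≤ |(γ₁ s j).1 - (x j).1| + |(γ₂ s j).1 - (x j).1| := abs_sub _ _
      _ ≤ t * Real.sqrt (2 * Y) + t * Real.sqrt (2 * Y) := add_le_add (hq₁ s hs j hj) (hq₂ s hs j hj)
      _ = 2 * Real.sqrt 2 * t * Real.sqrt Y := by rw [hsq]; ring
  exact df_iterate h₁ h₂ h0 hLip hD

/-- **Energy-type bounds for the severed flow in `Λ_{μ,n}`, in the format of `df_iterate_energy`**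
(relative to the bigger box `Λ_{μ,n+1}` ⊇ all sites met): pinning energies, bond energies and
displacements are controlled by `W_{μ,n+1}(x)`. [cite: ButtaMarchioro2016, §3 eqs. (3.6)–(3.8)] -/
theorem severedFlow_energy_format (hU : ContDiff ℝ 2 P.U) (hV : ContDiff ℝ 2 P.V)
    (hU0 : ∀ r, 0 ≤ P.U r) (hV0 : ∀ r, 0 ≤ P.V r) (hVe : ∀ r, P.V (-r) = P.V r) (hB1 : P.CondB1)
    (μ : ℤ) (n : ℕ) (x : ChainConfig) {Y : ℝ} (hY : P.bmLocalEnergy μ (n + 1) x ≤ Y) (s : ℝ) :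
    (∀ j ∈ Finset.Icc (μ - (n + 1 : ℕ)) (μ + (n + 1 : ℕ)),
      P.U (severedFlow hB1 (Finset.Icc (μ - n) (μ + n)) s x j).1 ≤ Y) ∧
    (∀ j ∈ Finset.Icc (μ - n - 1) (μ + n),
      P.V ((severedFlow hB1 (Finset.Icc (μ - n) (μ + n)) s x (j + 1)).1 -
        (severedFlow hB1 (Finset.Icc (μ - n) (μ + n)) s x j).1) ≤ Y) ∧
    (∀ j ∈ Finset.Icc (μ - (n + 1 : ℕ)) (μ + (n + 1 : ℕ)),
      |(severedFlow hB1 (Finset.Icc (μ - n) (μ + n)) s x j).1 - (x j).1| ≤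
        |s| * Real.sqrt (2 * Y)) ∧
    (∀ j ∈ Finset.Icc (μ - n) (μ + n),
      |(severedFlow hB1 (Finset.Icc (μ - n) (μ + n)) s x j).2| ≤ Real.sqrt (2 * Y)) := by
  set Λ := Finset.Icc (μ - n) (μ + n) with hΛ
  have hE := severedFlow_energy_bounds hU hV hU0 hV0 hB1 hVe μ n x s
  have hfro : ∀ j ∉ Λ, severedFlow hB1 Λ s x j = x j := fun j hj =>
    severedFlow_apply_of_not_mem hB1 Λ s x hj
  have hW0 : 0 ≤ P.bmLocalEnergy μ (n + 1) x :=
    zero_le_one.trans (one_le_bmLocalEnergy hU0 hV0 μ (n + 1) x)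
  refine ⟨fun j hj => ?_, fun j hj => ?_, fun j hj => ?_, fun j hj => ?_⟩
  · by_cases hjΛ : j ∈ Λ
    · exact (hE.1 j hjΛ).2.trans hY
    · rw [hfro j hjΛ]
      have h := site_le_bmLocalEnergy hU0 hV0 x hj
      nlinarith [sq_nonneg (x j).2]
  · have hjb : j ∈ sevBonds Λ := by
      rw [Finset.mem_Icc] at hj
      by_cases hjΛ : j ∈ Λ
      · exact Finset.mem_union_left _ hjΛ
      · refine Finset.mem_union_right _ (Finset.mem_image.2 ⟨j + 1, ?_, by ring⟩)
        rw [hΛ, Finset.mem_Icc] at hjΛ ⊢; omega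
    exact (hE.2.1 j hjb).trans hY
  · by_cases hjΛ : j ∈ Λ
    · calc |(severedFlow hB1 Λ s x j).1 - (x j).1|
          ≤ |s| * Real.sqrt (2 * P.bmLocalEnergy μ (n + 1) x) :=
            severedFlow_displacement_le hU hV hU0 hV0 hB1 hVe μ n x hjΛ s
        _ ≤ |s| * Real.sqrt (2 * Y) := by gcongr
    · rw [hfro j hjΛ, sub_self, abs_zero]; positivity
  · have h := (hE.1 j hj).1
    calc |(severedFlow hB1 Λ s x j).2| = Real.sqrt ((severedFlow hB1 Λ s x j).2 ^ 2) :=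
          (Real.sqrt_sq_eq_abs _).symm
      _ ≤ Real.sqrt (2 * Y) := Real.sqrt_le_sqrt (by linarith)

end EngineEnergy

end OscillatorChain

end Literature.MathematicalPhysics.KineticTheory.HeatConduction

end
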